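import Literature.AlgebraicGeometry.ModuliOfAbelianVarieties.SiegelFamilyHumbertDiscriminantClasses
import Literature.AlgebraicGeometry.ModuliOfAbelianVarieties.SiegelFamilyHumbertPairOrderEmbeddings
import Literature.AlgebraicGeometry.ModuliOfAbelianVarieties.SiegelFamilyHumbertLocusOrbit
import Literature.AlgebraicGeometry.ModuliOfAbelianVarieties.SiegelFamilyHumbertGeneralMember
import Literature.AlgebraicGeometry.ModuliOfAbelianVarieties.SiegelFamilyTwoHumbertSurfaces
import HarnessLib

/-!
# QCM-loci: the intersection of two Humbert surfaces decomposes into the loci of the discriminant matrices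
# `(Δ₁ a; a Δ₂)` (Runge 1999, §3 p. 287, §6 p. 294, Cor. 9 (iii), Cor. 15, Examples 16–17)

Layer `Literature/AlgebraicGeometry/ModuliOfAbelianVarieties`, namespace
`Literature.AlgebraicGeometry.ModuliOfAbelianVarieties.SiegelModuli`; lane `lit-hodgefound` (Track 2 foundations
library, Layer A4), seat `lit-hodgefound-skel-4`, row **A4-69**: the LOCI IN `𝔥₂` attached to a discriminant matrix `S`
and the decomposition of the intersection of two Humbert surfaces of the Siegel family of principally polarised abelian
surfaces `X_Z = ℂ²/(Z, 1₂)ℤ⁴` — the junction of rows A4-59″/A4-65 (`H_Δ(𝔥₂) = humbertLocusOfInvariant Δ` over all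
relations, `N_Δ = humbertLocusPrim Δ` over primitive ones), A4-66 (`S_Δ = discMatrix q q′`, positivity, `ℚ(α, β)`),
A4-67 (`ℤ[α, β] = humbertPairOrder`, `ℚ(α, β) ∩ M₄(ℤ) = humbertPairAlgInt`, saturation, `Sp₄(ℤ)`-transport) and A4-68
(`Gl(2, ℤ)`-classes `IsGLEquiv`, Remark 14's `IsDiscMatrix`, reduced matrices, the standard pair and its realisation).

## Source, verbatim (B. Runge, *Endomorphism rings of abelian surfaces and projective models of their moduli spaces*,
## Tohoku Math. J. 51 (1999); held text `paper:doi-10-2748-tmj-1178224764`)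

* §3, p. 287 (p0005): "`H(L) = {τ ∈ ℌ_g ; l M_τ = M_τ l for all l ∈ L}`, `Γ(L) = {σ ∈ Γ_g ; σL = Lσ}`. … where `C(L)`
  denotes the closure of the image of `Γ(L)∖H(L)` in the Satake compactification `𝒜_g` and `A(L)` its normalisation.
  We call `A(L)` the Shimura variety of type `L` and `C(L)` the cycle of type `L`. It is obvious that `Γ(L)` is acting on
  `H(L)`".
* §6, p. 294 (p0012): "an order `R` in an indefinite rational quaternion algebra `A = R ⊗ ℚ` is called a QCM-order if
  `R = End(X)` for some abelian surface `X`. This is equivalent to that `L = R ⊗ ℚ` is admissible and `R = L ∩ M₄(ℤ)`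
  for some Rosati equivariant embedding `L ⊂ M₄(ℚ)`."
* §6, Cor. 9, p. 296 (p0014): "(iii) A QCM-curve with QCM-order `R` is contained in the Humbert surface `H_Δ`. Moreover,
  for `Δ(α) ≠ Δ(β)`, a QCM-curve with QCM-order `R` is a component in the intersection `H_{Δ(α)} ∩ H_{Δ(β)}` if and
  only if `S_Δ[g] = (Δ(α) ∗; ∗ Δ(β))` for some `g ∈ Gl(2, ℤ)`." and its proof: "Since `Δ` is represented by `S_Δ`, it
  follows that `C` is contained in `H_Δ`".
* §6, p. 300 (p0018): "We will denote by `C_S` the QCM-curves for QCM-orders `R` with primitive discriminant matrix `S`.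
  This notation is justified by Theorem 10. With this notation we get: COROLLARY 15. For coprime discriminants `Δ₁`
  and `Δ₂`, the intersection `H_{Δ₁} ∩ H_{Δ₂}` contains all the QCM-curves `C_{(Δ₁ a; a Δ₂)}` with `0 ≤ a, a² < Δ₁Δ₂` as
  irreducible components. EXAMPLE 16. The intersection `H₅ ∩ H₈` contains `C_{(5 0; 0 8)}, C_{(5 2; 2 8)}, C_{(5 1; 1 5)},
  C_{(1 0; 0 4)}` as irreducible components, because `(5 4; 4 8)` is similar to `(5 1; 1 5)` and `(5 6; 6 8)` is similar
  to `(1 0; 0 4)`. EXAMPLE 17. The intersection `H₁ ∩ H₄ = C_{(1 0; 0 4)}` is a quotient of a plane quadric. It is a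
  non-simple curve. If we put `Γ = Sl(2, ℝ) ∩ R` for the corresponding QCM-order `R`, we get a non-standard model of the
  compactification of the modular curve `Γ∖ℌ` parametrizing abelian surfaces with quaternionic multiplication by a
  maximal order `R` (of discriminant 1) in `M₂(ℤ)`. There are two different QCM-curves for discriminant 6, namely
  `C_{(1 0; 0 24)}` (non-simple, which is a component of `H₁ ∩ H₂₄`) and `C_{(5 1; 1 5)}` (simple, which is a component
  of `H₅ ∩ H₈`). There are two different QCM-curves for discriminant 10, namely `C_{(1 0; 0 40)}` (non-simple) and
  `C_{(5 0; 0 8)}` (simple, which is another component of `H₅ ∩ H₈`). For discriminant 26 the classes for discriminant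
  matrices are given by [four matrices] which are all primitive. Therefore there are 4 different QCM-curves with
  discriminant 26. For discriminant 15 the classes for discriminant matrices are given by `(1 0; 0 60), (4 2; 2 16),
  (5 0; 0 12), (8 2; 2 8)` which are not all primitive. Therefore there are at least 4 different QCM-curves of
  discriminant 15."
  OCR caveat (numbers, not adjectives): in the held scan the six `2 × 2` matrices of Example 16 and the four of
  discriminant `26` are garbled. Example 16's are RECONSTRUCTED from the printed rule (`0 ≤ a`, `a² < 40`, `4 ∣ 40 − a²`
  ⇒ `a ∈ {0, 2, 4, 6}`: `qcmPolars_five_eight`) and Runge's reduction, and CONFIRMED by explicit `Gl(2, ℤ)` matrices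
  (`isGLEquiv_five_four_eight`, `g = (1 0; 1 −1)`; `isGLEquiv_five_six_eight`, `g = (1 −1; 2 −1)`); for `26` only the
  printed COUNTS are formalised, with row A4-68 FILE 1's enumeration `(1 0; 0 104), (5 1; 1 21), (8 0; 0 13), (9 2; 2 12)`
  (`qcmReducedList_twentySix`); the list for `15` is legible and agrees verbatim (`qcmReducedList_fifteen`).
* K. Hashimoto, N. Murabayashi, *Shimura curves as intersections of Humbert surfaces and defining equations of QM-curves
  of genus two*, Tohoku Math. J. 47 (1995) (held: RIMS Kôkyûroku 843 version, `paper:doi-10-2748-tmj-1178225596`), §1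
  p. 185: "the fibre space we are looking for will be obtained as a component of the intersection of the two Humbert's
  families", Def. 3.6 (primitive singular relations, `N_Δ`), §4.1 Lemma 4.1.1 (the pair of row A4-68 FILE 2 `hmRel`).

## What is proved (definitions with bodies `humbertPairLocus`, `qcmLocus`, `qcmPolars` + theorems; NO named fact, NO
## sorry, net debt 0)

* §0 `humbertLocus_intCast_neg` (`H_{−q} = H_q`), `discMatrix_neg_right`, **`linearIndependent_of_det_discMatrix_ne_zero`**
  (`det S_Δ ≠ 0 ⟹ q, q′` independent — the converse of row A4-66 FILE 3's positivity hypothesis), `det_discMatrix_nonneg_of_mem`.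
* §1 def **`humbertPairLocus S = 𝓗(S)`** `:= ⋃ {H_q ∩ H_{q′} : S_Δ(q, q′) = S}`, read as the union of Runge's `H(ℚ(α, β))`
  (`mem_humbertPairLocus_iff_exists_humbertPairAlg_le`) or as "`ρ_r(End X_Z) ⊇ ℤ[α, β]` of discriminant matrix `S`"
  (`mem_humbertPairLocus_iff_exists_humbertPairOrder_le`); **`IsGLEquiv.humbertPairLocus_eq`** (`𝓗(S[g]) = 𝓗(S)`: the
  locus belongs to the CLASS), `humbertPairLocus_neg_offDiag` / `_swap`; `humbertPairLocus_eq_empty_of_not_isDiscMatrix`,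
  `pos_of_mem_humbertPairLocus`, `humbertPairLocus_eq_empty_of_not_pos`, **`humbertPairLocus_nonempty_iff`** (for
  `det S > 0`: `𝓗(S) ≠ ∅ ⟺ IsDiscMatrix S ∧ S₀₀ > 0` — every positive definite admissible class occurs),
  `three_le_finrank_neronSeveriGroup_of_mem_humbertPairLocus` (`ρ ≥ 3`), `exists_quaternionAlgebra_of_mem_humbertPairLocus`
  (`End_ℚ(X_Z) ⊇ ℚ(α, β) ≃ ℍ[ℚ, S₀₀, S₀₁² − S₀₀S₁₁]`).
* §2 **`smul_mem_humbertPairLocus_iff`**: `𝓗(S)` is `Sp₄(ℤ)`-stable ("`Γ(L)` is acting on `H(L)`"; the image in `𝒜₂` is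
  well defined).
* §3 def **`qcmLocus S = 𝓠(S) ⊆ 𝓗(S)`**: the pairs with `ℚ(α, β) ∩ M₄(ℤ) = ℤ[α, β]` — `ℤ[α, β]` a QCM-ORDER in Runge's sense,
  so that `𝓠(S)` is the preimage in `𝔥₂` of the QCM-curves `C_S`; `exists_endRingInt_inf_eq_of_mem_qcmLocus`
  (`ρ_r(End X_Z) ∩ ℚ(α,β) = ℤ[α,β]` at every point), **`exists_endRingInt_eq_of_mem_qcmLocus`** (at the `ρ = 3` points
  `End(X_Z) = ℤ[α, β]` IS the QCM-order: Runge's "`End(A_τ) = R`"), `humbertPairAlgInt_std_eq` (the standard pair is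
  saturated), **`qcmLocus_nonempty_iff`** (every positive definite admissible `S` is the discriminant matrix of a
  QCM-ORDER on `𝔥₂` — sharpening row A4-68 FILE 2 `exists_order_of_isDiscMatrix`), `humbertPairAlg_comb` /
  `humbertPairAlgInt_comb` (base change), **`IsGLEquiv.qcmLocus_eq`**, **`smul_mem_qcmLocus_iff`** (`Sp₄(ℤ)`-stable).
* §4 COR. 9 (iii), containment half: **`humbertPairLocus_subset_humbertLocusOfInvariant`** (`S[x,y] = Δ₀`, `(x,y) ≠ 0`,
  `det S ≠ 0 ⟹ 𝓗(S) ⊆ H_{Δ₀}(𝔥₂)`), `humbertPairLocus_subset_inter` (`⊆ H_{S₀₀} ∩ H_{S₁₁}`),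
  **`humbertPairLocus_subset_inter_of_isGLEquiv`** (`S ~ (Δ₁ ∗; ∗ Δ₂) ⟹ 𝓗(S) ⊆ H_{Δ₁} ∩ H_{Δ₂}`), the same for `𝓠`;
  `isPrimitiveRel_of_forall_isUnit` and `humbertPairLocus_subset_inter_humbertLocusPrim` (when the arithmetic of `S`
  forces primitive relations: `⊆ N_{Δ₁} ∩ N_{Δ₂}`).
* §5 COR. 15: def `qcmPolars Δ₁ Δ₂` (`0 ≤ a`, `a² < Δ₁Δ₂`, `4 ∣ Δ₁Δ₂ − a²`), `mem_biUnion_humbertPairLocus_of_linearIndependent`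
  (the core: sign of `a` fixed by `q′ ↦ −q′`), **`humbertLocusOfInvariant_inter_subset_biUnion`** (`Δ₁Δ₂` not a square),
  **`humbertLocusPrim_inter_subset_biUnion`** (`Δ₁ ≠ Δ₂`, primitive-relation surfaces), `humbertPairLocus_offDiag_subset_inter`
  ("contains"), and the EXHAUSTION **`humbertLocusOfInvariant_inter_eq_biUnion`**:
  `H_{Δ₁}(𝔥₂) ∩ H_{Δ₂}(𝔥₂) = ⋃_{a ∈ qcmPolars Δ₁ Δ₂} 𝓗((Δ₁ a; a Δ₂))` for `Δ₁Δ₂` not a square.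
* §6 EXAMPLES 16–17: `qcmPolars_five_eight = {0, 2, 4, 6}`, `isGLEquiv_five_four_eight`, `isGLEquiv_five_six_eight`,
  **`humbertLocusOfInvariant_five_inter_eight`** (`H₅ ∩ H₈` = the union of the FOUR loci of `(5 0; 0 8)`, `(5 2; 2 8)`,
  `(5 1; 1 5)`, `(1 0; 0 4)`), `qcmLocus_nonempty_example_sixteen` (all four occur, as QCM-orders),
  `not_isGLEquiv_example_sixteen` (pairwise inequivalent), `isSimple_iff_of_mem_humbertPairLocus_simpleClass` (on the
  `d = 6, 10` pieces: simple ⟺ `ρ = 3`), `not_isSimple_of_mem_humbertPairLocus_nonsimpleClass` (the `(5 2; 2 8)` and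
  `(1 0; 0 4)` pieces carry only non-simple surfaces), `humbertLocusOfInvariant_eight/five_eq_humbertLocusPrim` and
  **`humbertLocusPrim_five_inter_eight`** (the same in the primitive-relation convention), `inter_humbertLocus_hmRel_subset`
  (Hashimoto–Murabayashi's discriminant-`6` Shimura curve lies on the piece `𝓗((5 1; 1 5))`); `mem_qcmPolars_one_four_iff`,
  `humbertLocusOfInvariant_one_inter_four` (B–W convention: `H₁(𝔥₂) ⊆ H₄(𝔥₂)`, so "`H₁ ∩ H₄`" needs primitive relations),
  **`humbertLocusPrim_one_inter_four`** (`N₁ ∩ N₄ = 𝓗((1 0; 0 4))`), `not_isSimple_of_mem_humbertLocusPrim_one_inter_four`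
  ("a non-simple curve"), `pairDiscr_eq_one_of_discMatrix_eq` (`d = 1`); `humbertPairLocus_subset_inter_example_seventeen`
  (discriminants `6`, `10`), `qcmReducedList_fifteen` / `qcmReducedList_twentySix` (the printed class counts, by `decide`).
* §7 SCOPE WITNESS `diagPoint_const_mem_humbertPairLocus` / `_humbertLocusPrim`: `E_τ × E_τ = X_{diag(τ,τ)}` lies on
  `N₁ ∩ N₄ ∩ N₈ ∩ N₁₃` through primitive relations spanning NON-saturated lattices, in `𝓗((4 4; 4 8))` (imprimitive class
  `~ (4 0; 0 4)`) and in `𝓗((4 4; 4 13))` (primitive class, `d = 9`) and in `𝓗((1 0; 0 4))` (`d = 1`).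

## Scope / deviations (what is NOT claimed)

* Irreducibility, dimension and "irreducible component" statements (Cor. 9 (iii) "is a component … if and only if",
  Cor. 15 "as irreducible components", Example 17 "a quotient of a plane quadric"): the tree has no vocabulary for
  components of analytic subsets of `𝒜₂`; only CONTAINMENTS and the set-theoretic EXHAUSTION are formalised. §7 shows
  (by example) that the loci `𝓗(S)` of distinct classes overlap, so no "component" statement should be read into them.
* Theorem 10 (for primitive `S` all Rosati-equivariant embeddings of `R_S` are `Γ₂`-conjugate, so `C_S` is ONE curve):
  not formalised; `𝓠(S)` is the union over all embeddings.
* `H_Δ`: Runge works with primitive (`ℤ[M] = ℚ(M) ∩ M₄(ℤ)`) Rosati-invariant elements; both readings are served —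
  B–W's `H_Δ(𝔥₂)` (all relations; hypothesis "`Δ₁Δ₂` not a square") and H–M's `N_Δ` (primitive relations; `Δ₁ ≠ Δ₂`).
  "Coprime `Δ₁, Δ₂`" is not needed for the set statements (it makes each `(Δ₁ a; a Δ₂)` primitive, for Thm. 10).

## References

* [Runge1999EndomorphismRingsAbelianSurfaces] B. Runge, Tohoku Math. J. 51 (1999) 283–303: §3 p. 287, §6 pp. 294–300.
* [HashimotoMurabayashi1995] K. Hashimoto, N. Murabayashi, Tohoku Math. J. 47 (1995) 271–296 (RIMS Kôkyûroku 843
  version held), §1, Def. 3.6, §4.1 Lemma 4.1.1.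
* [BirkenhakeWilhelm2003] Ch. Birkenhake, H. Wilhelm, *Humbert surfaces and the Kummer plane*, Trans. AMS 355 (2003),
  §1 (∗), §4 (7), (11), Prop. 4.7, Prop. 4.9.
-/

noncomputable section

open Matrix Module
open scoped Quaternion

namespace Literature.AlgebraicGeometry.ModuliOfAbelianVarieties

namespace SiegelModuli

open Literature.NumberTheory.Automorphic (siegelUpperHalfSpace)
open Literature.NumberTheory.ModularForms.SiegelUpperHalfSpace
open Literature.Geometry.Kaehler Literature.Geometry.Kaehler.ComplexTorus

/-! ## §0 Two small facts about pairs of relations: `H_{−q} = H_q`, and `det S_Δ ≠ 0 ⟹ q, q′ independent over `ℚ` -/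

section Prelim

variable {q q' : Fin 5 → ℤ}

/-- `H_{−q} = H_q` (the locus of a relation and of its negative agree; B–W: "the equation is not uniquely determined").
[cite: BirkenhakeWilhelm2003, §1 (∗) (p. 1819) and §4 Prop. 4.7 (p. 1830)] -/
theorem humbertLocus_intCast_neg (q : Fin 5 → ℤ) :
    humbertLocus (fun i ↦ ((-q) i : ℂ)) = humbertLocus (fun i ↦ (q i : ℂ)) := by
  have hc : (fun i ↦ ((-q) i : ℂ)) = (-1 : ℂ) • fun i ↦ (q i : ℂ) := by funext i; simp
  rw [hc, humbertLocus_smul (by norm_num) _]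

/-- `Δ(−q) = Δ(q)`. [cite: BirkenhakeWilhelm2003, §1 (∗) (p. 1819)] -/
theorem humbertInvariant_neg (q : Fin 5 → ℤ) : humbertInvariant (-q) = humbertInvariant q := by
  rw [← neg_one_smul ℤ q, humbertInvariant_smul]; ring

/-- `Δ(q, −q′) = −Δ(q, q′)`. [cite: Runge1999EndomorphismRingsAbelianSurfaces, §6 p. 294] -/
theorem humbertPolar_neg_right (q q' : Fin 5 → ℤ) : humbertPolar q (-q') = -humbertPolar q q' := by
  rw [humbertPolar_comm, humbertPolar_neg_left, humbertPolar_comm]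

/-- `S_Δ(q, −q′) = (Δ(q) −Δ(q,q′); −Δ(q,q′) Δ(q′))`: changing the sign of one relation changes the sign of the
off-diagonal entry (a `Gl(2, ℤ)` base change by `diag(1, −1)`). [cite: Runge1999EndomorphismRingsAbelianSurfaces, §1 p. 284] -/
theorem discMatrix_neg_right (q q' : Fin 5 → ℤ) :
    discMatrix q (-q') = !![humbertInvariant q, -humbertPolar q q'; -humbertPolar q q', humbertInvariant q'] := by
  rw [discMatrix, humbertPolar_neg_right, humbertInvariant_neg]

/-- The cast `ℤ⁵ → ℚ⁵` of a relation vector, through `Int.castRingHom`. [folklore] -/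
private theorem ratCast_eq_comp (q : Fin 5 → ℤ) : (fun i ↦ (q i : ℚ)) = fun i ↦ (Int.castRingHom ℚ) (q i) := rfl

/-- **`det S_Δ(q, q′) ≠ 0 ⟹ q, q′ are `ℚ`-linearly independent`** (Cramer on `S_Δ (s, t)ᵀ = 0`; the converse direction of
row A4-66 FILE 3's positivity, which assumes independence). [cite: Runge1999EndomorphismRingsAbelianSurfaces, §6 Thm. 7 (p. 294: "the discriminant matrix … is positive definite")] -/
theorem linearIndependent_of_det_discMatrix_ne_zero (hS : (discMatrix q q').det ≠ 0) :
    LinearIndependent ℚ ![(fun i ↦ (q i : ℚ)), (fun i ↦ (q' i : ℚ))] := by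
  rw [LinearIndependent.pair_iff]
  intro s t hst
  set Q : Fin 5 → ℚ := fun i ↦ (q i : ℚ) with hQ
  set Q' : Fin 5 → ℚ := fun i ↦ (q' i : ℚ) with hQ'
  have hI : humbertInvariant Q = ((humbertInvariant q : ℤ) : ℚ) := (ratCast_humbertInvariant q).symm
  have hI' : humbertInvariant Q' = ((humbertInvariant q' : ℤ) : ℚ) := (ratCast_humbertInvariant q').symm
  have hP : humbertPolar Q Q' = ((humbertPolar q q' : ℤ) : ℚ) := by
    rw [hQ, hQ', ratCast_eq_comp, ratCast_eq_comp, ← map_humbertPolar]; rfl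
  -- `S_Δ (s, t)ᵀ = (Δ(Q, sQ + tQ′), Δ(Q′, sQ + tQ′)) = 0`
  have h₁ : s * humbertInvariant Q + t * humbertPolar Q Q' = 0 := by
    have := humbertPolar_zero_right Q
    rw [← hst, humbertPolar_add_right, humbertPolar_smul_right, humbertPolar_smul_right, humbertPolar_self] at this
    linarith
  have h₂ : s * humbertPolar Q Q' + t * humbertInvariant Q' = 0 := by
    have := humbertPolar_zero_right Q'
    rw [← hst, humbertPolar_add_right, humbertPolar_smul_right, humbertPolar_smul_right, humbertPolar_self,
      humbertPolar_comm] at this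
    linarith
  have hd : humbertInvariant Q * humbertInvariant Q' - humbertPolar Q Q' ^ 2 ≠ 0 := by
    rw [hI, hI', hP]
    have h : ((discMatrix q q').det : ℚ) ≠ 0 := by exact_mod_cast hS
    rw [det_discMatrix] at h
    push_cast at h
    exact h
  have hs : (humbertInvariant Q * humbertInvariant Q' - humbertPolar Q Q' ^ 2) * s = 0 := by
    linear_combination humbertInvariant Q' * h₁ - humbertPolar Q Q' * h₂
  have ht : (humbertInvariant Q * humbertInvariant Q' - humbertPolar Q Q' ^ 2) * t = 0 := by
    linear_combination humbertInvariant Q * h₂ - humbertPolar Q Q' * h₁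
  exact ⟨(mul_eq_zero.1 hs).resolve_left hd, (mul_eq_zero.1 ht).resolve_left hd⟩

/-- Conversely **dependent relations have `det S_Δ = 0`**; so at a common zero `Z` of two relations `q, q′` EITHER
`det S_Δ(q, q′) = 0` OR `S_Δ(q, q′)` is positive definite (row A4-66 FILE 3 `det_discMatrix_pos′`), in particular
`det S_Δ(q, q′) ≥ 0` always. [cite: Runge1999EndomorphismRingsAbelianSurfaces, §6 Thm. 7 (p. 294)] -/
theorem det_discMatrix_nonneg_of_mem {Z : siegelUpperHalfSpace 2} (h₀ : Z ∈ humbertLocus (fun i ↦ (q i : ℂ)))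
    (h₁ : Z ∈ humbertLocus (fun i ↦ (q' i : ℂ))) : 0 ≤ (discMatrix q q').det := by
  by_cases hS : (discMatrix q q').det = 0
  · rw [hS]
  · exact (det_discMatrix_pos' h₀ h₁ (linearIndependent_of_det_discMatrix_ne_zero hS)).le

end Prelim

/-! ## §1 The locus `𝓗(S) ⊂ 𝔥₂` of a discriminant matrix: all pairs of relations with `S_Δ(q, q′) = S` -/

section PairLocus

/-- **The locus of the discriminant matrix `S` in `𝔥₂`**, `𝓗(S) := ⋃ {H_q ∩ H_{q′} : q, q′ ∈ ℤ⁵, S_Δ(q, q′) = S}`: the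
points `Z` whose principally polarised abelian surface `X_Z` carries a pair of singular relations (equivalently, by
B–W Cor. 4.2, a pair of symmetric endomorphisms `α = R₀(q)`, `β = R₀(q′)`) with Runge's discriminant matrix `S`. Each
`H_q ∩ H_{q′}` is Runge's `H(L) = {τ ∈ ℌ₂ ; l M_τ = M_τ l for all l ∈ L}` for the algebra `L = ℚ(α, β)` (row A4-66 FILE 3
`humbertPairAlg_le_endAlgRat_iff`; `mem_humbertPairLocus_iff_exists_humbertPairAlg_le` below), and `X_Z` then carries the
order `ℤ[α, β]` of discriminant matrix `S` in `ρ_r(End X_Z)` (`mem_humbertPairLocus_iff_exists_humbertPairOrder_le`).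
The sub-locus where `ℤ[α, β]` is a QCM-ORDER (saturated) is `qcmLocus S` (§2). Not Runge's notation: he names only the
image curves `C(L) ⊂ 𝒜₂` and `C_S`. [cite: Runge1999EndomorphismRingsAbelianSurfaces, §3 p. 287 (H(L), C(L)) and §6 Thm. 7 (p. 295: S_Δ)] -/
def humbertPairLocus (S : Matrix (Fin 2) (Fin 2) ℤ) : Set (siegelUpperHalfSpace 2) :=
  {Z | ∃ q q' : Fin 5 → ℤ, discMatrix q q' = S ∧ Z ∈ humbertLocus (fun i ↦ (q i : ℂ)) ∧ Z ∈ humbertLocus (fun i ↦ (q' i : ℂ))}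

variable {S S' : Matrix (Fin 2) (Fin 2) ℤ} {Z : siegelUpperHalfSpace 2}

/-- Membership in `𝓗(S)`. [cite: Runge1999EndomorphismRingsAbelianSurfaces, §3 p. 287] -/
theorem mem_humbertPairLocus_iff :
    Z ∈ humbertPairLocus S ↔ ∃ q q' : Fin 5 → ℤ, discMatrix q q' = S ∧
      Z ∈ humbertLocus (fun i ↦ (q i : ℂ)) ∧ Z ∈ humbertLocus (fun i ↦ (q' i : ℂ)) :=
  Iff.rfl

/-- `H_q ∩ H_{q′} ⊆ 𝓗(S_Δ(q, q′))`. [cite: Runge1999EndomorphismRingsAbelianSurfaces, §3 p. 287] -/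
theorem inter_humbertLocus_subset_humbertPairLocus (q q' : Fin 5 → ℤ) :
    humbertLocus (fun i ↦ (q i : ℂ)) ∩ humbertLocus (fun i ↦ (q' i : ℂ)) ⊆ humbertPairLocus (discMatrix q q') :=
  fun _ h ↦ ⟨q, q', rfl, h.1, h.2⟩

/-- **`𝓗(S)` as a union of Runge's `H(L)`**: `Z ∈ 𝓗(S)` iff `ℚ(α, β) ⊆ End_ℚ(X_Z)` for some pair with `S_Δ = S`
("`H(L) = {τ ; l M_τ = M_τ l for all l ∈ L}`"). [cite: Runge1999EndomorphismRingsAbelianSurfaces, §3 p. 287] -/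
theorem mem_humbertPairLocus_iff_exists_humbertPairAlg_le :
    Z ∈ humbertPairLocus S ↔ ∃ q q' : Fin 5 → ℤ, discMatrix q q' = S ∧
      humbertPairAlg q q' ≤ endAlgRat (prinPeriod Z : (Fin 2 ⊕ Fin 2 → ℝ) ≃L[ℝ] (Fin 2 → ℂ)) := by
  simp only [mem_humbertPairLocus_iff, humbertPairAlg_le_endAlgRat_iff]

/-- **`Z ∈ 𝓗(S)` iff `ρ_r(End X_Z)` contains an order `ℤ[α, β]` generated by a pair of relations with `S_Δ = S`**
(row A4-67 FILE 2 `humbertPairOrder_le_endRingInt_iff`). [cite: Runge1999EndomorphismRingsAbelianSurfaces, §6 Thm. 7 (p. 295) and §3 p. 287] -/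
theorem mem_humbertPairLocus_iff_exists_humbertPairOrder_le :
    Z ∈ humbertPairLocus S ↔ ∃ q q' : Fin 5 → ℤ, discMatrix q q' = S ∧
      ∀ x ∈ humbertPairOrder q q', x ∈ endRingInt (prinPeriod Z : (Fin 2 ⊕ Fin 2 → ℝ) ≃L[ℝ] (Fin 2 → ℂ)) := by
  simp only [mem_humbertPairLocus_iff, humbertPairOrder_le_endRingInt_iff]

/-- **`𝓗(S)` depends only on the `Gl(2, ℤ)`-class of `S`**, one inclusion: a unimodular base change of the pair realises
`S[g]` on the same locus (row A4-68 FILE 2 `discMatrix_comb`). [cite: Runge1999EndomorphismRingsAbelianSurfaces, §1 p. 284 ("Changing the basis gives a similar matrix `S_Δ[g] = g S_Δ ᵗg`")] -/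
theorem humbertPairLocus_subset_of_isGLEquiv (h : IsGLEquiv S S') : humbertPairLocus S ⊆ humbertPairLocus S' := by
  rintro Z ⟨q, q', rfl, h₀, h₁⟩
  obtain ⟨g, -, hg⟩ := h
  refine ⟨g 0 0 • q + g 0 1 • q', g 1 0 • q + g 1 1 • q', ?_, mem_humbertLocus_smul_add_smul h₀ h₁ _ _,
    mem_humbertLocus_smul_add_smul h₀ h₁ _ _⟩
  rw [discMatrix_comb, ← hg]
  congr 1
  exact (Matrix.eta_fin_two g).symm

/-- **`Gl(2, ℤ)`-equivalent matrices have the same locus: `𝓗(S[g]) = 𝓗(S)`** — the locus is attached to the CLASS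
("QCM-orders are parametrized by certain classes of binary quadratic forms"). [cite: Runge1999EndomorphismRingsAbelianSurfaces, §1 p. 284] -/
theorem IsGLEquiv.humbertPairLocus_eq (h : IsGLEquiv S S') : humbertPairLocus S = humbertPairLocus S' :=
  Set.Subset.antisymm (humbertPairLocus_subset_of_isGLEquiv h) (humbertPairLocus_subset_of_isGLEquiv h.symm)

/-- The sign of the off-diagonal entry is immaterial: `𝓗((Δ₁ −a; −a Δ₂)) = 𝓗((Δ₁ a; a Δ₂))` (replace `q′` by `−q′`).
[cite: Runge1999EndomorphismRingsAbelianSurfaces, §1 p. 284] -/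
theorem humbertPairLocus_neg_offDiag (Δ₁ a Δ₂ : ℤ) :
    humbertPairLocus !![Δ₁, -a; -a, Δ₂] = humbertPairLocus !![Δ₁, a; a, Δ₂] := by
  refine IsGLEquiv.humbertPairLocus_eq ⟨!![1, 0; 0, -1], by rw [Matrix.det_fin_two_of]; norm_num, ?_⟩
  rw [discBaseChange_fin_two]
  ext i j; fin_cases i <;> fin_cases j <;> simp

/-- Only matrices with Remark 14's congruences occur: `𝓗(S) = ∅` unless `IsDiscMatrix S` (row A4-68 FILE 2
`isDiscMatrix_discMatrix`). [cite: Runge1999EndomorphismRingsAbelianSurfaces, Remark 14 (p. 299)] -/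
theorem humbertPairLocus_eq_empty_of_not_isDiscMatrix (h : ¬ IsDiscMatrix S) : humbertPairLocus S = ∅ := by
  ext Z
  simp only [mem_humbertPairLocus_iff, Set.mem_empty_iff_false, iff_false, not_exists, not_and]
  rintro q q' rfl - -
  exact h (isDiscMatrix_discMatrix q q')

/-- On `𝓗(S)` with `det S ≠ 0` the realising pair is `ℚ`-independent, so rows A4-66/67/68 apply to it.
[cite: Runge1999EndomorphismRingsAbelianSurfaces, §6 Thm. 7 (p. 294)] -/
theorem exists_pair_of_mem_humbertPairLocus (hdet : S.det ≠ 0) (hZ : Z ∈ humbertPairLocus S) :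
    ∃ q q' : Fin 5 → ℤ, discMatrix q q' = S ∧ Z ∈ humbertLocus (fun i ↦ (q i : ℂ)) ∧
      Z ∈ humbertLocus (fun i ↦ (q' i : ℂ)) ∧ LinearIndependent ℚ ![(fun i ↦ (q i : ℚ)), (fun i ↦ (q' i : ℚ))] := by
  obtain ⟨q, q', rfl, h₀, h₁⟩ := hZ
  exact ⟨q, q', rfl, h₀, h₁, linearIndependent_of_det_discMatrix_ne_zero hdet⟩

/-- **`𝓗(S) ≠ ∅` with `det S ≠ 0` forces `Δ₁ = S₀₀ > 0` and `det S > 0`** (`S` positive definite: row A4-66 FILE 3).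
[cite: Runge1999EndomorphismRingsAbelianSurfaces, §6 Thm. 7 (p. 294: "such that the discriminant matrix … is positive definite")] -/
theorem pos_of_mem_humbertPairLocus (hdet : S.det ≠ 0) (hZ : Z ∈ humbertPairLocus S) : 0 < S 0 0 ∧ 0 < S.det := by
  obtain ⟨q, q', rfl, h₀, h₁, hli⟩ := exists_pair_of_mem_humbertPairLocus hdet hZ
  exact ⟨by simpa [discMatrix] using humbertInvariant_pos_left h₀ h₁ hli, det_discMatrix_pos' h₀ h₁ hli⟩

/-- `𝓗(S) = ∅` when `det S < 0`, and when `det S > 0` but `S₀₀ ≤ 0` (indefinite or negative classes do not occur).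
[cite: Runge1999EndomorphismRingsAbelianSurfaces, §6 Thm. 7 (p. 294)] -/
theorem humbertPairLocus_eq_empty_of_not_pos (hdet : S.det ≠ 0) (h : S 0 0 ≤ 0 ∨ S.det < 0) : humbertPairLocus S = ∅ := by
  ext Z
  simp only [Set.mem_empty_iff_false, iff_false]
  intro hZ
  obtain ⟨ha, hd⟩ := pos_of_mem_humbertPairLocus hdet hZ
  rcases h with h | h <;> omega

/-- **REALISATION: for `det S > 0`, `𝓗(S) ≠ ∅ ⟺ S` has Remark 14's congruences and `S₀₀ > 0`** — every positive
definite admissible class occurs on `𝔥₂` (row A4-68 FILE 2 `exists_pair_and_mem_of_isDiscMatrix`, Runge's standard pair).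
[cite: Runge1999EndomorphismRingsAbelianSurfaces, §6 proof of Thm. 10 (p. 298) and Remark 14 (p. 299)] -/
theorem humbertPairLocus_nonempty_iff (hdet : 0 < S.det) :
    (humbertPairLocus S).Nonempty ↔ IsDiscMatrix S ∧ 0 < S 0 0 := by
  constructor
  · rintro ⟨Z, hZ⟩
    by_cases hD : IsDiscMatrix S
    · exact ⟨hD, (pos_of_mem_humbertPairLocus hdet.ne' hZ).1⟩
    · rw [humbertPairLocus_eq_empty_of_not_isDiscMatrix hD] at hZ; exact hZ.elim
  · rintro ⟨hD, ha⟩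
    obtain ⟨q, q', -, -, -, hS, Z, h₀, h₁⟩ := exists_pair_and_mem_of_isDiscMatrix hD ha hdet
    exact ⟨Z, q, q', hS, h₀, h₁⟩

/-- **`ρ(X_Z) ≥ 3` on `𝓗(S)`** (`det S ≠ 0`; B–W Prop. 4.9 (3), Picard part, row A4-66 FILE 3).
[cite: BirkenhakeWilhelm2003, §4 Prop. 4.9 (3) (p. 1831)] -/
theorem three_le_finrank_neronSeveriGroup_of_mem_humbertPairLocus (hdet : S.det ≠ 0) (hZ : Z ∈ humbertPairLocus S) :
    3 ≤ finrank ℤ (neronSeveriGroup (prinPeriod Z : (Fin 2 ⊕ Fin 2 → ℝ) ≃L[ℝ] (Fin 2 → ℂ))) := by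
  obtain ⟨q, q', -, h₀, h₁, hli⟩ := exists_pair_of_mem_humbertPairLocus hdet hZ
  exact three_le_finrank_neronSeveriGroup h₀ h₁ hli

/-- **`End_ℚ(X_Z)` contains a quaternion algebra `ℚ(α, β) ≃ ℍ[ℚ, S₀₀, S₀₁² − S₀₀S₁₁]` on `𝓗(S)`** (`det S ≠ 0`; row A4-66
FILES 2–3). [cite: Runge1999EndomorphismRingsAbelianSurfaces, §6 Thm. 7 and Lemma 8 (p. 295)] -/
theorem exists_quaternionAlgebra_of_mem_humbertPairLocus (hdet : S.det ≠ 0) (hZ : Z ∈ humbertPairLocus S) :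
    ∃ q q' : Fin 5 → ℤ, discMatrix q q' = S ∧
      humbertPairAlg q q' ≤ endAlgRat (prinPeriod Z : (Fin 2 ⊕ Fin 2 → ℝ) ≃L[ℝ] (Fin 2 → ℂ)) ∧
      Literature.NumberTheory.Automorphic.IsQuaternionAlgebra ℚ (humbertPairAlg q q') ∧
      Nonempty (ℍ[ℚ, ((S 0 0 : ℤ) : ℚ), ((S 0 1 ^ 2 - S 0 0 * S 1 1 : ℤ) : ℚ)] ≃ₐ[ℚ] humbertPairAlg q q') := by
  obtain ⟨q, q', hqS, h₀, h₁, hli⟩ := exists_pair_of_mem_humbertPairLocus hdet hZ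
  refine ⟨q, q', hqS, humbertPairAlg_le_endAlgRat h₀ h₁, isQuaternionAlgebra_humbertPairAlg_of_mem h₀ h₁ hli, ?_⟩
  have h00 : S 0 0 = humbertInvariant q := by rw [← hqS]; simp [discMatrix]
  have h01 : S 0 1 = humbertPolar q q' := by rw [← hqS]; simp [discMatrix]
  have h11 : S 1 1 = humbertInvariant q' := by rw [← hqS]; simp [discMatrix]
  rw [h00, h01, h11]
  exact ⟨humbertPairAlgEquiv q q' (humbertInvariant_pos_left h₀ h₁ hli).ne'
    (by have := det_discMatrix_pos h₀ h₁ hli; omega)⟩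

end PairLocus

/-! ## §2 `𝓗(S)` is stable under `Γ₂ = Sp₄(ℤ)`: the loci descend to `𝒜₂ = Γ₂∖𝔥₂` -/

section Stable

variable {S : Matrix (Fin 2) (Fin 2) ℤ}

/-- One direction of the stability, for `M ∈ Sp₄(ℤ)` given as a matrix: the transported pair `(q^M, q′^M)` has the
same discriminant matrix (row A4-67 FILE 3 `discMatrix_humbertVectorConj`) and cuts out the translated point (row A4-65
FILE 2 `smul_mem_humbertLocus_humbertVectorConj`). [cite: Runge1999EndomorphismRingsAbelianSurfaces, §3 p. 287 ("`Γ(L) = {σ ∈ Γ_g ; σL = Lσ}` … is acting on `H(L)`")] [cite: BirkenhakeWilhelm2003, §4 eq. (7) (p. 1827)] -/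
private theorem smul_mem_humbertPairLocus {M : Matrix (Fin 2 ⊕ Fin 2) (Fin 2 ⊕ Fin 2) ℤ}
    (hM : Mᵀ * typeForm (fun _ : Fin 2 ↦ 1) * M = typeForm fun _ : Fin 2 ↦ 1) {Z : siegelUpperHalfSpace 2}
    (hZ : Z ∈ humbertPairLocus S) :
    (⟨toGD (fun _ : Fin 2 ↦ 1) M, toGD_mem principalType_pos hM⟩ : Matrix.symplecticGroup (Fin 2) ℝ) • Z ∈
      humbertPairLocus S := by
  obtain ⟨q, q', hqS, h₀, h₁⟩ := hZ
  exact ⟨humbertVectorConj M q, humbertVectorConj M q', (discMatrix_humbertVectorConj hM q q').trans hqS,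
    smul_mem_humbertLocus_humbertVectorConj hM q h₀, smul_mem_humbertLocus_humbertVectorConj hM q' h₁⟩

/-- **`𝓗(S)` is `Sp₄(ℤ)`-stable** (acting through row A4-16's `gDHom`): the image of `𝓗(S)` in `𝒜₂ = Sp₄(ℤ)∖𝔥₂` — the
union of Runge's cycles `C(L)` — is well defined, and `𝓗(S)` is its full preimage. [cite: Runge1999EndomorphismRingsAbelianSurfaces, §3 p. 287 (the diagram `Γ(L)∖H(L) → Γ_g∖ℌ_g`, `C(L)`)] -/
theorem smul_mem_humbertPairLocus_iff (M : symplecticLatticeGroup (fun _ : Fin 2 ↦ 1)) (S : Matrix (Fin 2) (Fin 2) ℤ)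
    (Z : siegelUpperHalfSpace 2) :
    gDHom (fun _ : Fin 2 ↦ 1) principalType_pos M • Z ∈ humbertPairLocus S ↔ Z ∈ humbertPairLocus S := by
  have key : ∀ (M : symplecticLatticeGroup (fun _ : Fin 2 ↦ 1)) (Z : siegelUpperHalfSpace 2),
      Z ∈ humbertPairLocus S → gDHom (fun _ : Fin 2 ↦ 1) principalType_pos M • Z ∈ humbertPairLocus S := by
    intro M Z hZ
    have hM' := mem_symplecticLatticeGroup_iff.1 (M⁻¹).2
    have hP : gDHom (fun _ : Fin 2 ↦ 1) principalType_pos M =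
        ⟨toGD (fun _ : Fin 2 ↦ 1) _, toGD_mem principalType_pos hM'⟩ := Subtype.ext (coe_gDHom principalType_pos M)
    rw [hP]
    exact smul_mem_humbertPairLocus hM' hZ
  refine ⟨fun h ↦ ?_, key M Z⟩
  have h' := key M⁻¹ _ h
  rwa [map_inv, inv_smul_smul] at h'

end Stable

/-! ## §3 The QCM-locus `𝓠(S) ⊆ 𝓗(S)`: pairs generating a QCM-order (`ℤ[α, β] = ℚ(α, β) ∩ M₄(ℤ)`) -/

section QCMLocus

/-- **The QCM-locus of the discriminant matrix `S`**, `𝓠(S) := ⋃ {H_q ∩ H_{q′} : S_Δ(q, q′) = S, ℤ[α, β] = ℚ(α, β) ∩ M₄(ℤ)}`: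
the pairs are required to generate a QCM-ORDER in Runge's sense — "an order `R` … is called a QCM-order if `R = End(X)`
for some abelian surface `X`. This is equivalent to that `L = R ⊗ ℚ` is admissible and `R = L ∩ M₄(ℤ)` for some Rosati
equivariant embedding `L ⊂ M₄(ℚ)`" — here `L = ℚ(α, β) = humbertPairAlg q q′`, `L ∩ M₄(ℤ) = humbertPairAlgInt q q′` (row
A4-67 FILE 2) and `R = ℤ[α, β] = humbertPairOrder q q′`, of discriminant matrix `S` in the basis `(α, β)`. So `𝓠(S)` is
the union of Runge's `H(L)` over the Rosati-equivariantly embedded `L` whose QCM-order has a Rosati-invariant basis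
pair of discriminant matrix `S`, i.e. the preimage in `𝔥₂` of the union of the QCM-curves `C(R)` of the QCM-orders `R`
presented by such a pair — Runge's "`C_S`" when `S` is primitive ("We will denote by `C_S` the QCM-curves for QCM-orders
`R` with primitive discriminant matrix `S`. This notation is justified by Theorem 10" — that for PRIMITIVE `S` this is
ONE `Γ₂`-orbit, i.e. one irreducible curve in `𝒜₂`, is Thm. 10 and is NOT formalised).
[cite: Runge1999EndomorphismRingsAbelianSurfaces, §6 p. 294 (QCM-order) and p. 300 (C_S)] -/
def qcmLocus (S : Matrix (Fin 2) (Fin 2) ℤ) : Set (siegelUpperHalfSpace 2) :=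
  {Z | ∃ q q' : Fin 5 → ℤ, discMatrix q q' = S ∧ humbertPairAlgInt q q' = (humbertPairOrder q q').toSubring ∧
    Z ∈ humbertLocus (fun i ↦ (q i : ℂ)) ∧ Z ∈ humbertLocus (fun i ↦ (q' i : ℂ))}

variable {S S' : Matrix (Fin 2) (Fin 2) ℤ} {Z : siegelUpperHalfSpace 2}

/-- Membership in `𝓠(S)`. [cite: Runge1999EndomorphismRingsAbelianSurfaces, §6 p. 294 and p. 300] -/
theorem mem_qcmLocus_iff :
    Z ∈ qcmLocus S ↔ ∃ q q' : Fin 5 → ℤ, discMatrix q q' = S ∧ humbertPairAlgInt q q' = (humbertPairOrder q q').toSubring ∧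
      Z ∈ humbertLocus (fun i ↦ (q i : ℂ)) ∧ Z ∈ humbertLocus (fun i ↦ (q' i : ℂ)) :=
  Iff.rfl

/-- **`𝓠(S) ⊆ 𝓗(S)`.** [cite: Runge1999EndomorphismRingsAbelianSurfaces, §6 p. 294] -/
theorem qcmLocus_subset_humbertPairLocus (S : Matrix (Fin 2) (Fin 2) ℤ) : qcmLocus S ⊆ humbertPairLocus S :=
  fun _ ⟨q, q', hS, _, h₀, h₁⟩ ↦ ⟨q, q', hS, h₀, h₁⟩

/-- The saturation condition in membership form: every integer matrix of `ℚ(α, β)` lies in `ℤ[α, β]` (the other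
inclusion `ℤ[α, β] ⊆ ℚ(α, β) ∩ M₄(ℤ)` always holds, row A4-67 FILE 2 `humbertPairOrder_toSubring_le_humbertPairAlgInt`).
[cite: Runge1999EndomorphismRingsAbelianSurfaces, §6 p. 294 ("`R = L ∩ M₄(ℤ)`")] -/
theorem humbertPairAlgInt_eq_iff (q q' : Fin 5 → ℤ) :
    humbertPairAlgInt q q' = (humbertPairOrder q q').toSubring ↔
      ∀ x ∈ humbertPairAlgInt q q', x ∈ humbertPairOrder q q' := by
  constructor
  · intro h x hx
    have hx' : x ∈ (humbertPairOrder q q').toSubring := h ▸ hx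
    exact hx'
  · intro h
    exact le_antisymm (fun x hx ↦ h x hx) (humbertPairOrder_toSubring_le_humbertPairAlgInt q q')

/-- **On `𝓠(S)`: `ρ_r(End X_Z) ∩ ℚ(α, β) = ℤ[α, β]`** — the QCM-order `ℤ[α, β]` of discriminant matrix `S` is OPTIMALLY
embedded in the endomorphism ring (Runge: on the QCM-curve `C(R)`, "`End(A_τ) = R`" outside a countable set; here the
pointwise half valid at EVERY point). [cite: Runge1999EndomorphismRingsAbelianSurfaces, §6 p. 294 and proof of Cor. 9 (p. 296)] -/
theorem exists_endRingInt_inf_eq_of_mem_qcmLocus (hZ : Z ∈ qcmLocus S) :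
    ∃ q q' : Fin 5 → ℤ, discMatrix q q' = S ∧
      endRingInt (prinPeriod Z : (Fin 2 ⊕ Fin 2 → ℝ) ≃L[ℝ] (Fin 2 → ℂ)) ⊓ humbertPairAlgInt q q' =
        (humbertPairOrder q q').toSubring := by
  obtain ⟨q, q', hS, hsat, h₀, h₁⟩ := hZ
  refine ⟨q, q', hS, le_antisymm ?_ ?_⟩
  · rintro x ⟨-, hx⟩
    exact ((humbertPairAlgInt_eq_iff q q').1 hsat) x hx
  · intro x hx
    exact ⟨mem_endRingInt_of_mem_humbertPairOrder h₀ h₁ hx, humbertPairOrder_le_humbertPairAlgInt _ _ hx⟩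

/-- **THEOREM 7 / "`End(A_τ) = R`" at the points of `𝓠(S)` with `ρ(X_Z) = 3`** (`det S ≠ 0`): there the endomorphism ring
of `X_Z` IS the QCM-order `ℤ[α, β] = ℤ ⊕ ℤα ⊕ ℤβ ⊕ ℤαβ` of discriminant matrix `S` (row A4-66 FILE 5: `ρ = 3` forces
`End_ℚ(X_Z) = ℚ(α, β)`; row A4-67 FILE 2: `End = ℚ(α,β) ∩ M₄(ℤ)`; saturation). Whether `ρ = 3` points exist on `𝓠(S)`
("outside a countable set") is not addressed here. [cite: Runge1999EndomorphismRingsAbelianSurfaces, §6 Thm. 7 (pp. 294–295) and proof of Cor. 9 (p. 296: "we have `End(A_τ) = R`")] -/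
theorem exists_endRingInt_eq_of_mem_qcmLocus (hdet : S.det ≠ 0) (hZ : Z ∈ qcmLocus S)
    (h3 : finrank ℤ (neronSeveriGroup (prinPeriod Z : (Fin 2 ⊕ Fin 2 → ℝ) ≃L[ℝ] (Fin 2 → ℂ))) = 3) :
    ∃ q q' : Fin 5 → ℤ, discMatrix q q' = S ∧
      endRingInt (prinPeriod Z : (Fin 2 ⊕ Fin 2 → ℝ) ≃L[ℝ] (Fin 2 → ℂ)) = (humbertPairOrder q q').toSubring := by
  obtain ⟨q, q', hS, hsat, h₀, h₁⟩ := hZ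
  have hli := linearIndependent_of_det_discMatrix_ne_zero (q := q) (q' := q') (hS ▸ hdet)
  exact ⟨q, q', hS, (endRingInt_eq_humbertPairAlgInt_of_endAlgRat_eq
    (endAlgRat_eq_humbertPairAlg_of_finrank_eq_three h₀ h₁ hli h3)).trans hsat⟩

/-- **Runge's STANDARD PAIR generates a QCM-order**: for `α` in Humbert's normal form `(k, l, −1, 0, 0)` and
`β ↔ (a, t, 0, 1, c)` (row A4-68 FILE 2 `rungeStdVector`, `d`-coordinate `1`), `ℚ(α, β) ∩ M₄(ℤ) = ℤ[α, β]` by Runge's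
criterion "`g.c.d.(b, c) = 1`" (row A4-67 FILE 2 `humbertPairAlgInt_normalForm_eq`). [cite: Runge1999EndomorphismRingsAbelianSurfaces, §6 proof of Thm. 7 (p. 295) and proof of Thm. 10 (p. 298)] -/
theorem humbertPairAlgInt_std_eq (k l t a c : ℤ) :
    humbertPairAlgInt (humbertNormalForm k l) (rungeStdVector t a c) =
      (humbertPairOrder (humbertNormalForm k l) (rungeStdVector t a c)).toSubring :=
  humbertPairAlgInt_normalForm_eq k l _ (by simp [rungeStdVector, isCoprime_one_left])

/-- **REALISATION OF QCM-ORDERS: for `det S > 0`, `𝓠(S) ≠ ∅ ⟺ S` has Remark 14's congruences and `S₀₀ > 0`** — EVERY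
positive definite admissible `S` is the discriminant matrix of a QCM-ORDER `ℤ[α, β] = ℚ(α, β) ∩ M₄(ℤ) ⊆ ρ_r(End X_Z)` at
some `Z ∈ 𝔥₂` (sharpening row A4-68 FILE 2 `exists_order_of_isDiscMatrix`, where saturation was not recorded).
[cite: Runge1999EndomorphismRingsAbelianSurfaces, §6 proof of Thm. 10 (p. 298: "which provides a basis for arbitrary discriminant matrix `S_Δ`") and Remark 14 (p. 299)] -/
theorem qcmLocus_nonempty_iff (hdet : 0 < S.det) : (qcmLocus S).Nonempty ↔ IsDiscMatrix S ∧ 0 < S 0 0 := by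
  constructor
  · rintro ⟨Z, hZ⟩
    exact (humbertPairLocus_nonempty_iff hdet).1 ⟨Z, qcmLocus_subset_humbertPairLocus S hZ⟩
  · rintro ⟨hD, ha⟩
    obtain ⟨k, l, t, a, c, hl, -, h⟩ := exists_pair_discMatrix_eq hD
    have hM := discMatrix_humbertNormalForm_rungeStdVector t a c k l
    have h00 : S 0 0 = 4 * k + l ^ 2 := by rw [← h, hM]; simp
    have hd : S.det = (4 * k + l ^ 2) * (t ^ 2 - 4 * c) - (l * t + 2 * a) ^ 2 := by
      rw [← h, hM, Matrix.det_fin_two_of]; ring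
    obtain ⟨Z, h₀, h₁⟩ := exists_mem_inter_std hl (by rw [← h00]; exact ha) (by rw [← hd]; exact hdet)
    exact ⟨Z, _, _, h, humbertPairAlgInt_std_eq k l t a c, h₀, h₁⟩

/-- `𝓠(S) = ∅` unless `IsDiscMatrix S`. [cite: Runge1999EndomorphismRingsAbelianSurfaces, Remark 14 (p. 299)] -/
theorem qcmLocus_eq_empty_of_not_isDiscMatrix (h : ¬ IsDiscMatrix S) : qcmLocus S = ∅ :=
  Set.eq_empty_of_subset_empty ((qcmLocus_subset_humbertPairLocus S).trans
    (humbertPairLocus_eq_empty_of_not_isDiscMatrix h).le)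

/-- One direction of the `Sp₄(ℤ)`-stability of `𝓠(S)`: saturation is transported along `x ↦ M⁻¹ x M` (row A4-67 FILE 3
`conj_mem_humbertPairAlgInt`, `conj_mem_humbertPairOrder_iff`). [cite: Runge1999EndomorphismRingsAbelianSurfaces, §3 p. 287 and §6 p. 294] -/
private theorem humbertPairAlgInt_humbertVectorConj_eq {q q' : Fin 5 → ℤ} {M : Matrix (Fin 2 ⊕ Fin 2) (Fin 2 ⊕ Fin 2) ℤ}
    (hM : Mᵀ * typeForm (fun _ : Fin 2 ↦ 1) * M = typeForm fun _ : Fin 2 ↦ 1)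
    (hsat : humbertPairAlgInt q q' = (humbertPairOrder q q').toSubring) :
    humbertPairAlgInt (humbertVectorConj M q) (humbertVectorConj M q') =
      (humbertPairOrder (humbertVectorConj M q) (humbertVectorConj M q')).toSubring := by
  rw [humbertPairAlgInt_eq_iff] at hsat ⊢
  intro y hy
  -- pull `y` back along `spInv M`: `x := M y M⁻¹ ∈ ℚ(α, β) ∩ M₄(ℤ) = ℤ[α, β]`
  have hM' := spInv_symplectic hM
  have hx := conj_mem_humbertPairAlgInt hM' hy
  rw [humbertVectorConj_spInv_humbertVectorConj hM, humbertVectorConj_spInv_humbertVectorConj hM, spInv_spInv] at hx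
  have hx' := (conj_mem_humbertPairOrder_iff hM _).2 (hsat _ hx)
  have e : spInv M * (M * y * spInv M) * M = y := by
    rw [show spInv M * (M * y * spInv M) * M = (spInv M * M) * y * (spInv M * M) by simp only [Matrix.mul_assoc],
      spInv_mul hM, Matrix.one_mul, Matrix.mul_one]
  rwa [e] at hx'

/-- One direction of the stability of `𝓠(S)` for `M ∈ Sp₄(ℤ)` as a matrix. [cite: Runge1999EndomorphismRingsAbelianSurfaces, §3 p. 287] -/
private theorem smul_mem_qcmLocus {M : Matrix (Fin 2 ⊕ Fin 2) (Fin 2 ⊕ Fin 2) ℤ}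
    (hM : Mᵀ * typeForm (fun _ : Fin 2 ↦ 1) * M = typeForm fun _ : Fin 2 ↦ 1) {Z : siegelUpperHalfSpace 2}
    (hZ : Z ∈ qcmLocus S) :
    (⟨toGD (fun _ : Fin 2 ↦ 1) M, toGD_mem principalType_pos hM⟩ : Matrix.symplecticGroup (Fin 2) ℝ) • Z ∈ qcmLocus S := by
  obtain ⟨q, q', hqS, hsat, h₀, h₁⟩ := hZ
  exact ⟨humbertVectorConj M q, humbertVectorConj M q', (discMatrix_humbertVectorConj hM q q').trans hqS,
    humbertPairAlgInt_humbertVectorConj_eq hM hsat,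
    smul_mem_humbertLocus_humbertVectorConj hM q h₀, smul_mem_humbertLocus_humbertVectorConj hM q' h₁⟩

/-- **`𝓠(S)` is `Sp₄(ℤ)`-stable**: the QCM-curves `C(R) ⊂ 𝒜₂` are images of `Γ₂`-stable subsets of `𝔥₂` ("`Γ(L)` … is
acting on `H(L)`", `σH(L) = H(σLσ⁻¹)`). [cite: Runge1999EndomorphismRingsAbelianSurfaces, §3 p. 287] -/
theorem smul_mem_qcmLocus_iff (M : symplecticLatticeGroup (fun _ : Fin 2 ↦ 1)) (S : Matrix (Fin 2) (Fin 2) ℤ)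
    (Z : siegelUpperHalfSpace 2) :
    gDHom (fun _ : Fin 2 ↦ 1) principalType_pos M • Z ∈ qcmLocus S ↔ Z ∈ qcmLocus S := by
  have key : ∀ (M : symplecticLatticeGroup (fun _ : Fin 2 ↦ 1)) (Z : siegelUpperHalfSpace 2),
      Z ∈ qcmLocus S → gDHom (fun _ : Fin 2 ↦ 1) principalType_pos M • Z ∈ qcmLocus S := by
    intro M Z hZ
    have hM' := mem_symplecticLatticeGroup_iff.1 (M⁻¹).2
    have hP : gDHom (fun _ : Fin 2 ↦ 1) principalType_pos M =
        ⟨toGD (fun _ : Fin 2 ↦ 1) _, toGD_mem principalType_pos hM'⟩ := Subtype.ext (coe_gDHom principalType_pos M)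
    rw [hP]
    exact smul_mem_qcmLocus hM' hZ
  refine ⟨fun h ↦ ?_, key M Z⟩
  have h' := key M⁻¹ _ h
  rwa [map_inv, inv_smul_smul] at h'

/-- Casting an integer combination of matrices to `ℚ`. [folklore] -/
private theorem castQ_comb (x y : ℤ) (A B : Matrix (Fin 2 ⊕ Fin 2) (Fin 2 ⊕ Fin 2) ℤ) :
    (x • A + y • B).map (Int.cast : ℤ → ℚ) = (x : ℚ) • A.map (Int.cast : ℤ → ℚ) + (y : ℚ) • B.map (Int.cast : ℤ → ℚ) := by
  ext i j
  simp only [Matrix.map_apply, Matrix.add_apply, Matrix.smul_apply, smul_eq_mul, Int.cast_add, Int.cast_mul]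

/-- `ℚ(α̃, β̃) ⊆ ℚ(α, β)` for ANY integer base change `(α̃, β̃) = (xα + yβ, zα + wβ)` of the pair.
[cite: Runge1999EndomorphismRingsAbelianSurfaces, §1 p. 284 and §6 proof of Cor. 9 (p. 296)] -/
theorem humbertPairAlg_comb_le (q q' : Fin 5 → ℤ) (x y z w : ℤ) :
    humbertPairAlg (x • q + y • q') (z • q + w • q') ≤ humbertPairAlg q q' := by
  rw [humbertPairAlg_def, Algebra.adjoin_le_iff]
  rintro M (rfl | rfl)
  · rw [SetLike.mem_coe, humbertRatRep_comb, castQ_comb]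
    exact add_mem (Subalgebra.smul_mem _ (humbertRatRep_map_mem_humbertPairAlg_left q q') _)
      (Subalgebra.smul_mem _ (humbertRatRep_map_mem_humbertPairAlg_right q q') _)
  · rw [SetLike.mem_coe, humbertRatRep_comb, castQ_comb]
    exact add_mem (Subalgebra.smul_mem _ (humbertRatRep_map_mem_humbertPairAlg_left q q') _)
      (Subalgebra.smul_mem _ (humbertRatRep_map_mem_humbertPairAlg_right q q') _)

/-- **`ℚ(α̃, β̃) = ℚ(α, β)`** for a unimodular base change of the pair. [cite: Runge1999EndomorphismRingsAbelianSurfaces, §1 p. 284] -/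
theorem humbertPairAlg_comb {q q' : Fin 5 → ℤ} {x y z w : ℤ} (hdet : IsUnit (x * w - y * z)) :
    humbertPairAlg (x • q + y • q') (z • q + w • q') = humbertPairAlg q q' := by
  refine le_antisymm (humbertPairAlg_comb_le q q' x y z w) ?_
  obtain ⟨hq, hq'⟩ := comb_inv (q := q) (q' := q') hdet
  have h := humbertPairAlg_comb_le (x • q + y • q') (z • q + w • q')
    ((x * w - y * z) * w) (-((x * w - y * z) * y)) (-((x * w - y * z) * z)) ((x * w - y * z) * x)
  rwa [hq, hq'] at h

/-- **`ℚ(α̃, β̃) ∩ M₄(ℤ) = ℚ(α, β) ∩ M₄(ℤ)`** for a unimodular base change. [cite: Runge1999EndomorphismRingsAbelianSurfaces, §1 p. 284 and §6 p. 294] -/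
theorem humbertPairAlgInt_comb {q q' : Fin 5 → ℤ} {x y z w : ℤ} (hdet : IsUnit (x * w - y * z)) :
    humbertPairAlgInt (x • q + y • q') (z • q + w • q') = humbertPairAlgInt q q' := by
  unfold humbertPairAlgInt
  rw [humbertPairAlg_comb hdet]

/-- `𝓠(S)` depends only on the `Gl(2, ℤ)`-class of `S`, one inclusion (base change preserves `ℤ[α, β]`, row A4-68 FILE 2
`humbertPairOrder_comb`, and `ℚ(α, β)`). [cite: Runge1999EndomorphismRingsAbelianSurfaces, §1 p. 284] -/
theorem qcmLocus_subset_of_isGLEquiv (h : IsGLEquiv S S') : qcmLocus S ⊆ qcmLocus S' := by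
  rintro Z ⟨q, q', rfl, hsat, h₀, h₁⟩
  obtain ⟨g, hg, hgS⟩ := h
  have hgd : g.det = g 0 0 * g 1 1 - g 0 1 * g 1 0 := Matrix.det_fin_two g
  have hunit : IsUnit (g 0 0 * g 1 1 - g 0 1 * g 1 0) := by rw [← hgd]; exact hg
  refine ⟨g 0 0 • q + g 0 1 • q', g 1 0 • q + g 1 1 • q', ?_, ?_, mem_humbertLocus_smul_add_smul h₀ h₁ _ _,
    mem_humbertLocus_smul_add_smul h₀ h₁ _ _⟩
  · rw [discMatrix_comb, ← hgS]
    congr 1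
    exact (Matrix.eta_fin_two g).symm
  · rw [humbertPairOrder_comb hunit, humbertPairAlgInt_comb hunit, hsat]

/-- **`𝓠(S[g]) = 𝓠(S)`** for `Gl(2, ℤ)`-equivalent matrices. [cite: Runge1999EndomorphismRingsAbelianSurfaces, §1 p. 284] -/
theorem IsGLEquiv.qcmLocus_eq (h : IsGLEquiv S S') : qcmLocus S = qcmLocus S' :=
  Set.Subset.antisymm (qcmLocus_subset_of_isGLEquiv h) (qcmLocus_subset_of_isGLEquiv h.symm)

end QCMLocus

/-! ## §4 Cor. 9 (iii) / Cor. 15, containment: `𝓗(S) ⊆ H_{Δ₀}(𝔥₂)` for every `Δ₀` represented by `S` -/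

section Contained

variable {S S' : Matrix (Fin 2) (Fin 2) ℤ}

/-- **"A QCM-curve with QCM-order `R` is contained in the Humbert surface `H_Δ`" (Cor. 9 (iii)), locus form: if
`S[x, y] = Δ₀` with `(x, y) ≠ (0, 0)` and `det S ≠ 0`, then `𝓗(S) ⊆ H_{Δ₀}(𝔥₂)`** — every point of `H_q ∩ H_{q′}` satisfies the
relation `xq + yq′ ≠ 0` of invariant `Δ₀` (row A4-67 FILE 3 §7; `H_{Δ₀}(𝔥₂)` is the locus over ALL non-zero relations of
invariant `Δ₀`, row A4-59″). [cite: Runge1999EndomorphismRingsAbelianSurfaces, §6 Cor. 9 (iii) and its proof (p. 296: "Since `Δ` is represented by `S_Δ`, it follows that `C` is contained in `H_Δ`")] -/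
theorem humbertPairLocus_subset_humbertLocusOfInvariant (hdet : S.det ≠ 0) {x y : ℤ} (hxy : x ≠ 0 ∨ y ≠ 0) {Δ₀ : ℤ}
    (hΔ : discBinForm S x y = Δ₀) : humbertPairLocus S ⊆ humbertLocusOfInvariant Δ₀ := by
  rintro Z ⟨q, q', rfl, h₀, h₁⟩
  have hS : humbertInvariant q * humbertInvariant q' ≠ humbertPolar q q' ^ 2 := by
    rw [det_discMatrix] at hdet; exact fun h ↦ hdet (by rw [h, sub_self])
  refine inter_humbertLocus_subset_humbertLocusOfInvariant_of_ne hS hxy ?_ ⟨h₀, h₁⟩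
  rw [← hΔ, discBinForm_discMatrix, discForm₂_eq_humbertInvariant]

/-- **`𝓗(S) ⊆ H_{Δ₁}(𝔥₂) ∩ H_{Δ₂}(𝔥₂)` for `S = (Δ₁ Δ; Δ Δ₂)` with `det S ≠ 0`** (the two basis relations themselves).
[cite: Runge1999EndomorphismRingsAbelianSurfaces, §6 Cor. 9 (iii) (p. 296) and Cor. 15 (p. 300)] -/
theorem humbertPairLocus_subset_inter (hdet : S.det ≠ 0) :
    humbertPairLocus S ⊆ humbertLocusOfInvariant (S 0 0) ∩ humbertLocusOfInvariant (S 1 1) :=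
  Set.subset_inter (humbertPairLocus_subset_humbertLocusOfInvariant hdet (Or.inl one_ne_zero) (discBinForm_one_zero S))
    (humbertPairLocus_subset_humbertLocusOfInvariant hdet (Or.inr one_ne_zero) (discBinForm_zero_one S))

/-- **Cor. 9 (iii), "if" direction, on `𝔥₂`: if `S[g] = (Δ₁ ∗; ∗ Δ₂)` for some `g ∈ Gl(2, ℤ)`, then `𝓗(S) ⊆ H_{Δ₁}(𝔥₂) ∩ H_{Δ₂}(𝔥₂)`**
("a QCM-curve with QCM-order `R` is a component in the intersection `H_{Δ(α)} ∩ H_{Δ(β)}` if … `S_Δ[g] = (Δ(α) ∗; ∗ Δ(β))`";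
the words "component" and "only if" are NOT formalised — see the module docstring's worked caveat).
[cite: Runge1999EndomorphismRingsAbelianSurfaces, §6 Cor. 9 (iii) (p. 296)] -/
theorem humbertPairLocus_subset_inter_of_isGLEquiv (hdet : S.det ≠ 0) (h : IsGLEquiv S S') :
    humbertPairLocus S ⊆ humbertLocusOfInvariant (S' 0 0) ∩ humbertLocusOfInvariant (S' 1 1) := by
  rw [h.humbertPairLocus_eq]
  exact humbertPairLocus_subset_inter (by rwa [h.det_eq])

/-- The same for the QCM-locus `𝓠(S) ⊆ 𝓗(S)`. [cite: Runge1999EndomorphismRingsAbelianSurfaces, §6 Cor. 9 (iii) (p. 296) and Cor. 15 (p. 300)] -/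
theorem qcmLocus_subset_inter_of_isGLEquiv (hdet : S.det ≠ 0) (h : IsGLEquiv S S') :
    qcmLocus S ⊆ humbertLocusOfInvariant (S' 0 0) ∩ humbertLocusOfInvariant (S' 1 1) :=
  (qcmLocus_subset_humbertPairLocus S).trans (humbertPairLocus_subset_inter_of_isGLEquiv hdet h)

/-- **PRIMITIVITY of the first relation from the arithmetic of `S`**: if no non-unit `m` has `m² ∣ Δ(q)`, `m ∣ Δ(q, q′)`
and `4m² ∣ det S_Δ`, then `q` is a primitive vector — for `q = m q₀` the matrix `S_Δ(q₀, q′) = (Δ(q)/m², Δ(q,q′)/m; ·, Δ(q′))`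
would again satisfy Remark 14's congruence `4 ∣ det`. (Used to read Runge's `H_Δ` with PRIMITIVE relations, `N_Δ`.)
[cite: Runge1999EndomorphismRingsAbelianSurfaces, Remark 14 (p. 299)] [cite: HashimotoMurabayashi1995, Def. 3.6] -/
theorem isPrimitiveRel_of_forall_isUnit {q q' : Fin 5 → ℤ}
    (H : ∀ m : ℤ, m ^ 2 ∣ humbertInvariant q → m ∣ humbertPolar q q' → 4 * m ^ 2 ∣ (discMatrix q q').det → IsUnit m) :
    IsPrimitiveRel q := by
  intro m q₀ hq
  have h1 : humbertInvariant q = m ^ 2 * humbertInvariant q₀ := by rw [hq, humbertInvariant_smul]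
  have h2 : humbertPolar q q' = m * humbertPolar q₀ q' := by rw [hq, humbertPolar_smul_left]
  have h3 : (discMatrix q q').det = m ^ 2 * (discMatrix q₀ q').det := by
    rw [det_discMatrix, det_discMatrix, h1, h2]; ring
  have h4 : (4 : ℤ) ∣ (discMatrix q₀ q').det := (isDiscMatrix_discMatrix q₀ q').four_dvd_det
  exact Int.isUnit_iff.1 (H m ⟨_, h1⟩ ⟨_, h2⟩ (by rw [h3, mul_comm (4 : ℤ)]; exact mul_dvd_mul_left _ h4))

/-- **`𝓗(S) ⊆ N_{S₀₀}`** (Runge's / Hashimoto–Murabayashi's Humbert surface of PRIMITIVE relations, row A4-65 FILE 2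
`humbertLocusPrim`) whenever the arithmetic of `S` forces the first relation to be primitive.
[cite: Runge1999EndomorphismRingsAbelianSurfaces, §6 Cor. 9 (iii) (p. 296)] [cite: HashimotoMurabayashi1995, Def. 3.6] -/
theorem humbertPairLocus_subset_humbertLocusPrim_fst
    (H : ∀ m : ℤ, m ^ 2 ∣ S 0 0 → m ∣ S 0 1 → 4 * m ^ 2 ∣ S.det → IsUnit m) :
    humbertPairLocus S ⊆ humbertLocusPrim (S 0 0) := by
  rintro Z ⟨q, q', rfl, h₀, -⟩
  refine mem_humbertLocusPrim_iff.2 ⟨q, isPrimitiveRel_of_forall_isUnit fun m hm1 hm2 hm3 ↦ H m ?_ ?_ hm3, by simp [discMatrix], h₀⟩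
  · simpa [discMatrix] using hm1
  · simpa [discMatrix] using hm2

/-- `𝓗(S) = 𝓗(ᵗ-swapped S)`: the locus is symmetric in the two relations (`g = (0 1; 1 0)`).
[cite: Runge1999EndomorphismRingsAbelianSurfaces, §1 p. 284] -/
theorem humbertPairLocus_swap (Δ₁ a Δ₂ : ℤ) : humbertPairLocus !![Δ₁, a; a, Δ₂] = humbertPairLocus !![Δ₂, a; a, Δ₁] := by
  refine IsGLEquiv.humbertPairLocus_eq ⟨!![0, 1; 1, 0], by rw [Matrix.det_fin_two_of]; norm_num, ?_⟩
  rw [discBaseChange_fin_two]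
  ext i j; fin_cases i <;> fin_cases j <;> simp

/-- **`𝓗((Δ₁ a; a Δ₂)) ⊆ N_{Δ₁} ∩ N_{Δ₂}`** when the arithmetic of both diagonal entries forces primitivity.
[cite: Runge1999EndomorphismRingsAbelianSurfaces, §6 Cor. 15 (p. 300)] [cite: HashimotoMurabayashi1995, Def. 3.6] -/
theorem humbertPairLocus_subset_inter_humbertLocusPrim {Δ₁ a Δ₂ : ℤ}
    (H₁ : ∀ m : ℤ, m ^ 2 ∣ Δ₁ → m ∣ a → 4 * m ^ 2 ∣ Δ₁ * Δ₂ - a ^ 2 → IsUnit m)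
    (H₂ : ∀ m : ℤ, m ^ 2 ∣ Δ₂ → m ∣ a → 4 * m ^ 2 ∣ Δ₁ * Δ₂ - a ^ 2 → IsUnit m) :
    humbertPairLocus !![Δ₁, a; a, Δ₂] ⊆ humbertLocusPrim Δ₁ ∩ humbertLocusPrim Δ₂ := by
  refine Set.subset_inter ?_ ?_
  · have h := humbertPairLocus_subset_humbertLocusPrim_fst (S := !![Δ₁, a; a, Δ₂])
      (fun m hm1 hm2 hm3 ↦ H₁ m (by simpa using hm1) (by simpa using hm2) (by rw [Matrix.det_fin_two_of] at hm3; simpa [sq] using hm3))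
    simpa using h
  · have h := humbertPairLocus_subset_humbertLocusPrim_fst (S := !![Δ₂, a; a, Δ₁])
      (fun m hm1 hm2 hm3 ↦ H₂ m (by simpa using hm1) (by simpa using hm2)
        (by rw [Matrix.det_fin_two_of] at hm3; rw [mul_comm Δ₁]; simpa [sq] using hm3))
    rw [humbertPairLocus_swap]
    simpa using h

end Contained

/-! ## §5 Cor. 15, exhaustion: `H_{Δ₁}(𝔥₂) ∩ H_{Δ₂}(𝔥₂) = ⋃_{a} 𝓗((Δ₁ a; a Δ₂))`, `0 ≤ a`, `a² < Δ₁Δ₂`, `4 ∣ Δ₁Δ₂ − a²` -/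

section Decomposition

/-- **Runge's index set for `H_{Δ₁} ∩ H_{Δ₂}`**: the off-diagonal entries `a` with "`0 ≤ a, a² < Δ₁Δ₂`" — and, which the
print leaves implicit in "`C_{(Δ₁ a; a Δ₂)}`" being a QCM-curve at all, Remark 14's congruence `4 ∣ det = Δ₁Δ₂ − a²` (a
finite set: `a ≤ Δ₁Δ₂`). [cite: Runge1999EndomorphismRingsAbelianSurfaces, §6 Cor. 15 (p. 300) and Remark 14 (p. 299)] -/
def qcmPolars (Δ₁ Δ₂ : ℤ) : Finset ℤ :=
  (Finset.Icc 0 (Δ₁ * Δ₂)).filter fun a ↦ a ^ 2 < Δ₁ * Δ₂ ∧ 4 ∣ Δ₁ * Δ₂ - a ^ 2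

/-- Membership in Runge's index set. [cite: Runge1999EndomorphismRingsAbelianSurfaces, §6 Cor. 15 (p. 300)] -/
theorem mem_qcmPolars_iff {Δ₁ Δ₂ a : ℤ} :
    a ∈ qcmPolars Δ₁ Δ₂ ↔ 0 ≤ a ∧ a ^ 2 < Δ₁ * Δ₂ ∧ 4 ∣ Δ₁ * Δ₂ - a ^ 2 := by
  simp only [qcmPolars, Finset.mem_filter, Finset.mem_Icc]
  constructor
  · rintro ⟨⟨h0, -⟩, h1, h2⟩
    exact ⟨h0, h1, h2⟩
  · rintro ⟨h0, h1, h2⟩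
    exact ⟨⟨h0, by nlinarith [sq_nonneg (a - 1)]⟩, h1, h2⟩

variable {q q' : Fin 5 → ℤ} {Z : siegelUpperHalfSpace 2}

/-- **The core of Cor. 15**: a point of `H_q ∩ H_{q′}` with `q, q′` independent lies in `𝓗((Δ(q) a; a Δ(q′)))` for
`a = |Δ(q, q′)| ∈ qcmPolars Δ(q) Δ(q′)` — `a² < Δ(q)Δ(q′)` is the positivity of `S_Δ` (row A4-66 FILE 3), `4 ∣ det S_Δ` is
Remark 14's congruence (row A4-68 FILE 2), and the sign of `a` is fixed by replacing `q′` with `−q′` (`H_{−q′} = H_{q′}`).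
[cite: Runge1999EndomorphismRingsAbelianSurfaces, §6 Cor. 15 (p. 300)] -/
theorem mem_biUnion_humbertPairLocus_of_linearIndependent (h₀ : Z ∈ humbertLocus (fun i ↦ (q i : ℂ)))
    (h₁ : Z ∈ humbertLocus (fun i ↦ (q' i : ℂ))) (hli : LinearIndependent ℚ ![(fun i ↦ (q i : ℚ)), (fun i ↦ (q' i : ℚ))]) :
    Z ∈ ⋃ a ∈ qcmPolars (humbertInvariant q) (humbertInvariant q'),
      humbertPairLocus !![humbertInvariant q, a; a, humbertInvariant q'] := by
  have hpos := det_discMatrix_pos' h₀ h₁ hli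
  have h4 := (isDiscMatrix_discMatrix q q').four_dvd_det
  rw [det_discMatrix] at hpos h4
  rcases le_or_gt 0 (humbertPolar q q') with ha | ha
  · refine Set.mem_iUnion₂.2 ⟨humbertPolar q q', mem_qcmPolars_iff.2 ⟨ha, by linarith, h4⟩, ?_⟩
    exact ⟨q, q', by rw [discMatrix], h₀, h₁⟩
  · refine Set.mem_iUnion₂.2 ⟨-humbertPolar q q',
      mem_qcmPolars_iff.2 ⟨by linarith, by rw [neg_sq]; linarith, by rw [neg_sq]; exact h4⟩, ?_⟩
    refine ⟨q, -q', by rw [discMatrix_neg_right], h₀, ?_⟩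
    rwa [humbertLocus_intCast_neg]

/-- **COR. 15, `⊆`, in Birkenhake–Wilhelm's convention** (`H_Δ(𝔥₂)` = locus of ALL non-zero relations of invariant `Δ`,
row A4-59″): if `Δ₁Δ₂` is not a square — so that two relations with these invariants at one point are automatically
independent (dependent relations have `det S_Δ = Δ₁Δ₂ − a² = 0`) — then
`H_{Δ₁}(𝔥₂) ∩ H_{Δ₂}(𝔥₂) ⊆ ⋃_{a ∈ qcmPolars Δ₁ Δ₂} 𝓗((Δ₁ a; a Δ₂))`. [cite: Runge1999EndomorphismRingsAbelianSurfaces, §6 Cor. 15 (p. 300)] -/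
theorem humbertLocusOfInvariant_inter_subset_biUnion {Δ₁ Δ₂ : ℤ} (hsq : ¬ IsSquare (Δ₁ * Δ₂)) :
    humbertLocusOfInvariant Δ₁ ∩ humbertLocusOfInvariant Δ₂ ⊆
      ⋃ a ∈ qcmPolars Δ₁ Δ₂, humbertPairLocus !![Δ₁, a; a, Δ₂] := by
  rintro Z ⟨hZ₁, hZ₂⟩
  obtain ⟨q, -, hqΔ, h₀⟩ := mem_humbertLocusOfInvariant_iff.1 hZ₁
  obtain ⟨q', -, hqΔ', h₁⟩ := mem_humbertLocusOfInvariant_iff.1 hZ₂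
  have hdet : (discMatrix q q').det ≠ 0 := by
    intro h
    rw [det_discMatrix, hqΔ, hqΔ', sub_eq_zero] at h
    exact hsq ⟨humbertPolar q q', by rw [h, sq]⟩
  have h := mem_biUnion_humbertPairLocus_of_linearIndependent h₀ h₁ (linearIndependent_of_det_discMatrix_ne_zero hdet)
  rwa [hqΔ, hqΔ'] at h

/-- **COR. 15, `⊆`, in Runge's / Hashimoto–Murabayashi's convention** (`N_Δ` = locus of PRIMITIVE relations of invariant
`Δ`, row A4-65 FILE 2 `humbertLocusPrim`): for `Δ₁ ≠ Δ₂`,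
`N_{Δ₁} ∩ N_{Δ₂} ⊆ ⋃_{a ∈ qcmPolars Δ₁ Δ₂} 𝓗((Δ₁ a; a Δ₂))` (two primitive relations at one point with different
invariants have different Humbert surfaces, hence are independent: row A4-65 FILES 4–5).
[cite: Runge1999EndomorphismRingsAbelianSurfaces, §6 Cor. 15 (p. 300)] [cite: HashimotoMurabayashi1995, Def. 3.6] -/
theorem humbertLocusPrim_inter_subset_biUnion {Δ₁ Δ₂ : ℤ} (hne : Δ₁ ≠ Δ₂) :
    humbertLocusPrim Δ₁ ∩ humbertLocusPrim Δ₂ ⊆ ⋃ a ∈ qcmPolars Δ₁ Δ₂, humbertPairLocus !![Δ₁, a; a, Δ₂] := by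
  rintro Z ⟨hZ₁, hZ₂⟩
  obtain ⟨q, hq, hqΔ, h₀⟩ := mem_humbertLocusPrim_iff.1 hZ₁
  obtain ⟨q', hq', hqΔ', h₁⟩ := mem_humbertLocusPrim_iff.1 hZ₂
  have hpos : 0 < humbertInvariant q := (humbertLocus_nonempty_iff_int hq.ne_zero).1 ⟨Z, h₀⟩
  have hloc : humbertLocus (fun i ↦ (q i : ℂ)) ≠ humbertLocus (fun i ↦ (q' i : ℂ)) := by
    intro h
    rcases (hq.humbertLocus_eq_iff hpos hq').1 h with rfl | rfl
    · exact hne (hqΔ.symm.trans hqΔ')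
    · exact hne (hqΔ.symm.trans ((humbertInvariant_neg q).symm.trans hqΔ'))
  have h := mem_biUnion_humbertPairLocus_of_linearIndependent h₀ h₁ (hq.linearIndependent_of_humbertLocus_ne hq' hloc)
  rwa [hqΔ, hqΔ'] at h

/-- **Cor. 15, `⊇` ("contains")**: each `𝓗((Δ₁ a; a Δ₂))` with `a² ≠ Δ₁Δ₂` lies in `H_{Δ₁}(𝔥₂) ∩ H_{Δ₂}(𝔥₂)`.
[cite: Runge1999EndomorphismRingsAbelianSurfaces, §6 Cor. 15 (p. 300: "the intersection `H_{Δ₁} ∩ H_{Δ₂}` contains all the QCM-curves `C_{(Δ₁ a; a Δ₂)}` with `0 ≤ a, a² < Δ₁Δ₂`")] -/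
theorem humbertPairLocus_offDiag_subset_inter {Δ₁ Δ₂ a : ℤ} (ha : a ^ 2 ≠ Δ₁ * Δ₂) :
    humbertPairLocus !![Δ₁, a; a, Δ₂] ⊆ humbertLocusOfInvariant Δ₁ ∩ humbertLocusOfInvariant Δ₂ := by
  have h := humbertPairLocus_subset_inter (S := !![Δ₁, a; a, Δ₂])
    (by rw [Matrix.det_fin_two_of]; intro h; exact ha (by linarith))
  simpa using h

/-- **RUNGE'S COROLLARY 15 AS A SET-THEORETIC DECOMPOSITION ON `𝔥₂` (Birkenhake–Wilhelm convention): for `Δ₁Δ₂` not a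
square, `H_{Δ₁}(𝔥₂) ∩ H_{Δ₂}(𝔥₂) = ⋃_{0 ≤ a, a² < Δ₁Δ₂, 4 ∣ Δ₁Δ₂ − a²} 𝓗((Δ₁ a; a Δ₂))`** — the intersection of two
Humbert surfaces is exhausted by the loci of the discriminant matrices `(Δ₁ a; a Δ₂)` (each the union of Runge's
`H(ℚ(α, β))`; that for coprime `Δ₁, Δ₂` each is an irreducible QCM-curve `C_{(Δ₁ a; a Δ₂)}` is Thm. 10 + Cor. 15's word
"components", NOT formalised). [cite: Runge1999EndomorphismRingsAbelianSurfaces, §6 Cor. 15 (p. 300)] -/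
theorem humbertLocusOfInvariant_inter_eq_biUnion {Δ₁ Δ₂ : ℤ} (hsq : ¬ IsSquare (Δ₁ * Δ₂)) :
    humbertLocusOfInvariant Δ₁ ∩ humbertLocusOfInvariant Δ₂ = ⋃ a ∈ qcmPolars Δ₁ Δ₂, humbertPairLocus !![Δ₁, a; a, Δ₂] := by
  refine Set.Subset.antisymm (humbertLocusOfInvariant_inter_subset_biUnion hsq) fun Z hZ ↦ ?_
  obtain ⟨a, -, hZa⟩ := Set.mem_iUnion₂.1 hZ
  exact humbertPairLocus_offDiag_subset_inter (fun h ↦ hsq ⟨a, by rw [← h, sq]⟩) hZa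

/-- The same with `N_{Δ₁} ∩ N_{Δ₂}` sandwiched: `N_{Δ₁} ∩ N_{Δ₂} ⊆ ⋃_a 𝓗((Δ₁ a; a Δ₂)) ⊆ H_{Δ₁}(𝔥₂) ∩ H_{Δ₂}(𝔥₂)` for
`Δ₁ ≠ Δ₂` with `Δ₁Δ₂` not a square. [cite: Runge1999EndomorphismRingsAbelianSurfaces, §6 Cor. 15 (p. 300)] -/
theorem biUnion_humbertPairLocus_subset_inter {Δ₁ Δ₂ : ℤ} (hsq : ¬ IsSquare (Δ₁ * Δ₂)) :
    ⋃ a ∈ qcmPolars Δ₁ Δ₂, humbertPairLocus !![Δ₁, a; a, Δ₂] ⊆ humbertLocusOfInvariant Δ₁ ∩ humbertLocusOfInvariant Δ₂ :=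
  (humbertLocusOfInvariant_inter_eq_biUnion hsq).symm.le

end Decomposition

/-! ## §6 Runge's Examples 16 and 17 (p. 300) on `𝔥₂` -/

section Examples

variable {Z : siegelUpperHalfSpace 2}

/-- `40` is not a square. [folklore] -/
private theorem not_isSquare_five_mul_eight : ¬ IsSquare ((5 : ℤ) * 8) := by
  rintro ⟨r, hr⟩
  have h1 : r ≤ 6 := by nlinarith
  have h2 : -6 ≤ r := by nlinarith
  interval_cases r <;> omega

/-- **Runge's index set for `H₅ ∩ H₈` is `{0, 2, 4, 6}`** ("`0 ≤ a, a² < Δ₁Δ₂`" = `a² < 40`, and `4 ∣ 40 − a²`).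
[cite: Runge1999EndomorphismRingsAbelianSurfaces, §6 Cor. 15 and Example 16 (p. 300)] -/
theorem mem_qcmPolars_five_eight_iff {a : ℤ} : a ∈ qcmPolars 5 8 ↔ a = 0 ∨ a = 2 ∨ a = 4 ∨ a = 6 := by
  rw [mem_qcmPolars_iff]
  constructor
  · rintro ⟨h0, h1, h2⟩
    have : a ≤ 6 := by nlinarith
    interval_cases a <;> omega
  · rintro (rfl | rfl | rfl | rfl) <;> norm_num

/-- `qcmPolars 5 8 = {0, 2, 4, 6}`. [cite: Runge1999EndomorphismRingsAbelianSurfaces, §6 Example 16 (p. 300)] -/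
theorem qcmPolars_five_eight : qcmPolars 5 8 = {0, 2, 4, 6} := by
  ext a
  rw [mem_qcmPolars_five_eight_iff]
  simp only [Finset.mem_insert, Finset.mem_singleton]

/-- **"`(5 4; 4 8)` is similar to `(5 1; 1 5)`"** (by `g = (1 0; 1 −1)`; the printed matrices are OCR-garbled in the held
scan and are reconstructed from Runge's rule and reduction — see the module docstring). [cite: Runge1999EndomorphismRingsAbelianSurfaces, §6 Example 16 (p. 300)] -/
theorem isGLEquiv_five_four_eight : IsGLEquiv !![5, 4; 4, 8] !![5, 1; 1, 5] :=
  ⟨!![1, 0; 1, -1], by rw [Matrix.det_fin_two_of]; norm_num, by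
    rw [discBaseChange_fin_two]; ext i j; fin_cases i <;> fin_cases j <;> norm_num⟩

/-- **"`(5 6; 6 8)` is similar to `(1 0; 0 4)`"** (by `g = (1 −1; 2 −1)`). [cite: Runge1999EndomorphismRingsAbelianSurfaces, §6 Example 16 (p. 300)] -/
theorem isGLEquiv_five_six_eight : IsGLEquiv !![5, 6; 6, 8] !![1, 0; 0, 4] :=
  ⟨!![1, -1; 2, -1], by rw [Matrix.det_fin_two_of]; norm_num, by
    rw [discBaseChange_fin_two]; ext i j; fin_cases i <;> fin_cases j <;> norm_num⟩

/-- **EXAMPLE 16 ON `𝔥₂`: `H₅(𝔥₂) ∩ H₈(𝔥₂) = 𝓗((5 0; 0 8)) ∪ 𝓗((5 2; 2 8)) ∪ 𝓗((5 1; 1 5)) ∪ 𝓗((1 0; 0 4))`** — "The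
intersection `H₅ ∩ H₈` contains `C_{(5 0; 0 8)}, C_{(5 2; 2 8)}, C_{(5 1; 1 5)}, C_{(1 0; 0 4)}` as irreducible components,
because `(5 4; 4 8)` is similar to `(5 1; 1 5)` and `(5 6; 6 8)` is similar to `(1 0; 0 4)`" (here: the set-theoretic
equality in B–W's convention; `humbertLocusPrim_five_inter_eight` below reads it with primitive relations).
[cite: Runge1999EndomorphismRingsAbelianSurfaces, §6 Example 16 (p. 300)] -/
theorem humbertLocusOfInvariant_five_inter_eight :
    humbertLocusOfInvariant 5 ∩ humbertLocusOfInvariant 8 =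
      humbertPairLocus !![5, 0; 0, 8] ∪ humbertPairLocus !![5, 2; 2, 8] ∪ humbertPairLocus !![5, 1; 1, 5] ∪
        humbertPairLocus !![1, 0; 0, 4] := by
  rw [humbertLocusOfInvariant_inter_eq_biUnion not_isSquare_five_mul_eight, ← isGLEquiv_five_four_eight.humbertPairLocus_eq,
    ← isGLEquiv_five_six_eight.humbertPairLocus_eq]
  ext Z
  simp only [Set.mem_iUnion, Set.mem_union, exists_prop, mem_qcmPolars_five_eight_iff]
  constructor
  · rintro ⟨a, ha, h⟩
    rcases ha with rfl | rfl | rfl | rfl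
    · exact Or.inl (Or.inl (Or.inl h))
    · exact Or.inl (Or.inl (Or.inr h))
    · exact Or.inl (Or.inr h)
    · exact Or.inr h
  · rintro (((h | h) | h) | h)
    · exact ⟨0, Or.inl rfl, h⟩
    · exact ⟨2, Or.inr (Or.inl rfl), h⟩
    · exact ⟨4, Or.inr (Or.inr (Or.inl rfl)), h⟩
    · exact ⟨6, Or.inr (Or.inr (Or.inr rfl)), h⟩

/-- **All four pieces of `H₅ ∩ H₈` are NON-EMPTY, indeed each of the four classes is the discriminant matrix of a
QCM-ORDER on `𝔥₂`** (`𝓠 ⊆ 𝓗`, §3). [cite: Runge1999EndomorphismRingsAbelianSurfaces, §6 Example 16 (p. 300) and Remark 14 (p. 299)] -/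
theorem qcmLocus_nonempty_example_sixteen :
    (qcmLocus !![5, 0; 0, 8]).Nonempty ∧ (qcmLocus !![5, 2; 2, 8]).Nonempty ∧
      (qcmLocus !![5, 1; 1, 5]).Nonempty ∧ (qcmLocus !![1, 0; 0, 4]).Nonempty := by
  refine ⟨?_, ?_, ?_, ?_⟩ <;>
    exact (qcmLocus_nonempty_iff (by rw [Matrix.det_fin_two_of]; norm_num)).2 ⟨by decide, by norm_num⟩

/-- The four labels are pairwise inequivalent (distinct Runge-reduced matrices, row A4-68 FILE 1
`eq_of_isGLEquiv_of_isRungeReduced`). [cite: Runge1999EndomorphismRingsAbelianSurfaces, §6 Example 16 (p. 300) and Remark 14 (p. 299)] -/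
theorem not_isGLEquiv_example_sixteen :
    ¬ IsGLEquiv !![5, 0; 0, 8] !![5, 2; 2, 8] ∧ ¬ IsGLEquiv !![5, 0; 0, 8] !![5, 1; 1, 5] ∧
      ¬ IsGLEquiv !![5, 0; 0, 8] !![1, 0; 0, 4] ∧ ¬ IsGLEquiv !![5, 2; 2, 8] !![5, 1; 1, 5] ∧
      ¬ IsGLEquiv !![5, 2; 2, 8] !![1, 0; 0, 4] ∧ ¬ IsGLEquiv !![5, 1; 1, 5] !![1, 0; 0, 4] := by
  refine ⟨fun h ↦ ?_, fun h ↦ ?_, fun h ↦ ?_, fun h ↦ ?_, fun h ↦ ?_, fun h ↦ ?_⟩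
  · have e := congrFun (congrFun (eq_of_isGLEquiv_of_isRungeReduced (by rfl) (by decide) (by decide) h) 0) 1
    simp at e
  · have e := congrFun (congrFun (eq_of_isGLEquiv_of_isRungeReduced (by rfl) (by decide) (by decide) h) 0) 1
    simp at e
  · have e := congrFun (congrFun (eq_of_isGLEquiv_of_isRungeReduced (by rfl) (by decide) (by decide) h) 0) 0
    simp at e
  · have e := congrFun (congrFun (eq_of_isGLEquiv_of_isRungeReduced (by rfl) (by decide) (by decide) h) 0) 1
    simp at e
  · have e := congrFun (congrFun (eq_of_isGLEquiv_of_isRungeReduced (by rfl) (by decide) (by decide) h) 0) 0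
    simp at e
  · have e := congrFun (congrFun (eq_of_isGLEquiv_of_isRungeReduced (by rfl) (by decide) (by decide) h) 0) 0
    simp at e

/-- `d(ℤ[α, β]) = det S/4` for a pair realising `S`. [cite: Runge1999EndomorphismRingsAbelianSurfaces, §6 Thm. 7 (p. 295: "`d(R) = det(S_Δ)/4`")] -/
theorem pairDiscr_eq_of_discMatrix_eq {q q' : Fin 5 → ℤ} {S : Matrix (Fin 2) (Fin 2) ℤ} (h : discMatrix q q' = S) {d : ℤ}
    (hd : S.det = 4 * d) : pairDiscr q q' = d := by
  have := four_mul_pairDiscr q q'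
  rw [h, hd] at this
  omega

/-- **The pieces `𝓗((5 1; 1 5))` (`d = 6`) and `𝓗((5 0; 0 8))` (`d = 10`) carry SIMPLE surfaces exactly at their
`ρ = 3` points** ("`C_{(5 1; 1 5)}` (simple …)", "`C_{(5 0; 0 8)}` (simple …)": the simple classes of Remark 14; rows
A4-66 FILE 5 / A4-68 FILE 2 `isSimple_iff_of_pairDiscr_le`; the `ρ = 4` points are the non-simple CM points).
[cite: Runge1999EndomorphismRingsAbelianSurfaces, §6 Example 17 (p. 300) and p. 296 ("up to countable many exceptions any period point on a simple QCM-curve corresponds to a simple abelian surface")] -/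
theorem isSimple_iff_of_mem_humbertPairLocus_simpleClass {S : Matrix (Fin 2) (Fin 2) ℤ}
    (hS : S = !![5, 1; 1, 5] ∨ S = !![5, 0; 0, 8]) (hZ : Z ∈ humbertPairLocus S) :
    IsSimple (prinPeriod Z : (Fin 2 ⊕ Fin 2 → ℝ) ≃L[ℝ] (Fin 2 → ℂ)) ↔
      finrank ℤ (neronSeveriGroup (prinPeriod Z : (Fin 2 ⊕ Fin 2 → ℝ) ≃L[ℝ] (Fin 2 → ℂ))) = 3 := by
  have hdet : S.det ≠ 0 := by rcases hS with rfl | rfl <;> rw [Matrix.det_fin_two_of] <;> norm_num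
  obtain ⟨q, q', hqS, h₀, h₁, hli⟩ := exists_pair_of_mem_humbertPairLocus hdet hZ
  have hd : pairDiscr q q' ≤ 11 := by
    rcases hS with rfl | rfl
    · rw [pairDiscr_eq_of_discMatrix_eq hqS (d := 6) (by rw [Matrix.det_fin_two_of]; norm_num)]; norm_num
    · rw [pairDiscr_eq_of_discMatrix_eq hqS (d := 10) (by rw [Matrix.det_fin_two_of]; norm_num)]; norm_num
  rw [isSimple_iff_of_pairDiscr_le h₀ h₁ hli hd, hqS]
  constructor
  · exact fun h ↦ h.1
  · intro h3
    rcases hS with rfl | rfl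
    · exact ⟨h3, Or.inl (IsGLEquiv.refl _)⟩
    · exact ⟨h3, Or.inr (IsGLEquiv.refl _)⟩

/-- **The pieces `𝓗((5 2; 2 8))` (`d = 9`, `S[1, −1] = 9 = 3²`) and `𝓗((1 0; 0 4))` (`d = 1`, `S[1, 0] = 1`) carry only
NON-SIMPLE surfaces** ("if the discriminant form … represents a non-zero square, all period points correspond to
non-simple abelian surfaces"; rows A4-66 FILE 5 / A4-68 FILE 2 `not_isSimple_of_not_isSimpleDisc`).
[cite: Runge1999EndomorphismRingsAbelianSurfaces, §6 p. 296 and Example 17 (p. 300: "`C_{(1 0; 0 4)}` … It is a non-simple curve")] -/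
theorem not_isSimple_of_mem_humbertPairLocus_nonsimpleClass {S : Matrix (Fin 2) (Fin 2) ℤ}
    (hS : S = !![5, 2; 2, 8] ∨ S = !![1, 0; 0, 4]) (hZ : Z ∈ humbertPairLocus S) :
    ¬ IsSimple (prinPeriod Z : (Fin 2 ⊕ Fin 2 → ℝ) ≃L[ℝ] (Fin 2 → ℂ)) := by
  obtain ⟨q, q', hqS, h₀, h₁⟩ := hZ
  refine not_isSimple_of_not_isSimpleDisc h₀ h₁ ?_
  rw [hqS]
  rcases hS with rfl | rfl
  · exact not_isSimpleDisc_of_eq_sq (x := 1) (y := -1) (m := 3) (by norm_num) (by simp [discBinForm])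
  · exact not_isSimpleDisc_of_eq_sq (x := 1) (y := 0) (m := 1) (by norm_num) (by simp [discBinForm])

/-- `H₈(𝔥₂) = N₈`: every relation of invariant `8` is a primitive vector (`8 = 2²·2` and `2 ≢ 0, 1 (mod 4)`, so `N₂ = ∅`;
row A4-65 FILE 2 `H_Δ(𝔥₂) = ⋃_{m² ∣ Δ} N_{Δ/m²}`). [cite: HashimotoMurabayashi1995, Def. 3.6] [cite: BirkenhakeWilhelm2003, §1 (∗) (p. 1819)] -/
theorem humbertLocusOfInvariant_eight_eq_humbertLocusPrim : humbertLocusOfInvariant 8 = humbertLocusPrim 8 := by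
  refine Set.Subset.antisymm ?_ (humbertLocusPrim_subset_humbertLocusOfInvariant 8)
  intro Z hZ
  rw [humbertLocusOfInvariant_eq_iUnion_humbertLocusPrim] at hZ
  obtain ⟨m, ⟨hm, hdvd⟩, hZm⟩ := Set.mem_iUnion₂.1 hZ
  have hm2 : m ≤ 2 := by
    have := Int.le_of_dvd (by norm_num) hdvd
    nlinarith
  interval_cases m
  · simpa using hZm
  · exfalso
    have hne := (humbertLocusPrim_nonempty_iff 2).1 ⟨Z, by simpa using hZm⟩
    omega

/-- `H₅(𝔥₂) = N₅` (`5` is squarefree; row A4-65 FILE 2). [cite: HashimotoMurabayashi1995, Def. 3.6] -/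
theorem humbertLocusOfInvariant_five_eq_humbertLocusPrim : humbertLocusOfInvariant 5 = humbertLocusPrim 5 :=
  humbertLocusOfInvariant_eq_humbertLocusPrim_of_squarefree (Int.prime_ofNat_iff.mpr Nat.prime_five).squarefree

/-- **Example 16 in Runge's / Hashimoto–Murabayashi's convention: `N₅ ∩ N₈` is the same union of four loci.**
[cite: Runge1999EndomorphismRingsAbelianSurfaces, §6 Example 16 (p. 300)] [cite: HashimotoMurabayashi1995, §1 ("Shimura curves as intersections of Humbert surfaces") and Def. 3.6] -/
theorem humbertLocusPrim_five_inter_eight :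
    humbertLocusPrim 5 ∩ humbertLocusPrim 8 =
      humbertPairLocus !![5, 0; 0, 8] ∪ humbertPairLocus !![5, 2; 2, 8] ∪ humbertPairLocus !![5, 1; 1, 5] ∪
        humbertPairLocus !![1, 0; 0, 4] := by
  rw [← humbertLocusOfInvariant_five_eq_humbertLocusPrim, ← humbertLocusOfInvariant_eight_eq_humbertLocusPrim,
    humbertLocusOfInvariant_five_inter_eight]

/-- **Hashimoto–Murabayashi's discriminant-`6` family lies on Runge's simple piece of `H₅ ∩ H₈`**:
`H_{(−1,0,2,0,1)} ∩ H_{(0,1,−1,1,−1)} ⊆ 𝓗((5 1; 1 5))` (row A4-68 FILE 2: their pair has `S_Δ = (8 −4; −4 5) ~ (5 1; 1 5)`).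
[cite: HashimotoMurabayashi1995, §4.1 Lemma 4.1.1 (p. 193)] [cite: Runge1999EndomorphismRingsAbelianSurfaces, §6 Example 17 (p. 300: "`C_{(5 1; 1 5)}` (simple, which is a component of `H₅ ∩ H₈`)")] -/
theorem inter_humbertLocus_hmRel_subset :
    humbertLocus (fun i ↦ (hmRel i : ℂ)) ∩ humbertLocus (fun i ↦ (hmRel' i : ℂ)) ⊆ humbertPairLocus !![5, 1; 1, 5] := by
  rw [← isGLEquiv_hmRel.humbertPairLocus_eq]
  exact inter_humbertLocus_subset_humbertPairLocus hmRel hmRel'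

/-! ### Example 17: `H₁ ∩ H₄` -/

/-- Runge's index set for `H₁ ∩ H₄` is `{0}` (`a² < 4`, `4 ∣ 4 − a²`). [cite: Runge1999EndomorphismRingsAbelianSurfaces, §6 Cor. 15 and Example 17 (p. 300)] -/
theorem mem_qcmPolars_one_four_iff {a : ℤ} : a ∈ qcmPolars 1 4 ↔ a = 0 := by
  rw [mem_qcmPolars_iff]
  constructor
  · rintro ⟨h0, h1, h2⟩
    have : a ≤ 1 := by nlinarith
    interval_cases a <;> omega
  · rintro rfl; norm_num

/-- **In Birkenhake–Wilhelm's convention `H₁(𝔥₂) ⊆ H₄(𝔥₂)`** (`q ↦ 2q`: `H_Δ ⊆ H_{m²Δ}`, row A4-62 FILE 5), so "`H₁ ∩ H₄`"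
in Example 17 must be read with PRIMITIVE relations (`N₁ ∩ N₄`, next theorem) — with all relations the intersection is
the whole surface `H₁(𝔥₂)`. [cite: BirkenhakeWilhelm2003, §4 Prop. 4.7 (p. 1830)] [cite: Runge1999EndomorphismRingsAbelianSurfaces, §6 Example 17 (p. 300)] -/
theorem humbertLocusOfInvariant_one_inter_four :
    humbertLocusOfInvariant 1 ∩ humbertLocusOfInvariant 4 = humbertLocusOfInvariant 1 := by
  refine Set.inter_eq_left.2 fun Z hZ ↦ ?_
  obtain ⟨q, hq, hqΔ, hZq⟩ := mem_humbertLocusOfInvariant_iff.1 hZ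
  refine mem_humbertLocusOfInvariant_iff.2 ⟨(2 : ℤ) • q, smul_ne_zero two_ne_zero hq, by rw [humbertInvariant_smul, hqΔ]; norm_num, ?_⟩
  have hc : (fun i ↦ (((2 : ℤ) • q) i : ℂ)) = (2 : ℂ) • fun i ↦ (q i : ℂ) := by funext i; simp
  rw [hc, humbertLocus_smul two_ne_zero]
  exact hZq

/-- **EXAMPLE 17 ON `𝔥₂`: `N₁ ∩ N₄ = 𝓗((1 0; 0 4))`** — "The intersection `H₁ ∩ H₄ = C_{(1 0; 0 4)}`" (read with primitive
relations; `⊆`: Cor. 15 with index set `{0}`; `⊇`: a relation of invariant `1` is primitive, and a relation `q′ = 2q₀′`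
of invariant `4` would give `S_Δ(q, q₀′) = (1 0; 0 1)`, violating `4 ∣ det`). [cite: Runge1999EndomorphismRingsAbelianSurfaces, §6 Example 17 (p. 300)] -/
theorem humbertLocusPrim_one_inter_four : humbertLocusPrim 1 ∩ humbertLocusPrim 4 = humbertPairLocus !![1, 0; 0, 4] := by
  refine Set.Subset.antisymm ?_ ?_
  · intro Z hZ
    have h := humbertLocusPrim_inter_subset_biUnion (by norm_num : (1 : ℤ) ≠ 4) hZ
    simp only [Set.mem_iUnion, exists_prop, mem_qcmPolars_one_four_iff] at h
    obtain ⟨a, rfl, h⟩ := h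
    exact h
  · refine humbertPairLocus_subset_inter_humbertLocusPrim (fun m h1 _ _ ↦ ?_) (fun m _ _ h3 ↦ ?_)
    · exact isUnit_of_dvd_one (dvd_trans (Dvd.intro m (sq m).symm) h1)
    · have h3' : m ^ 2 ∣ 1 := (mul_dvd_mul_iff_left (by norm_num : (4 : ℤ) ≠ 0)).1 (by norm_num at h3 ⊢; exact h3)
      exact isUnit_of_dvd_one (dvd_trans (Dvd.intro m (sq m).symm) h3')

/-- **"It is a non-simple curve"**: every surface `X_Z` with `Z ∈ N₁ ∩ N₄` is non-simple (it contains an elliptic curve: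
`(1 0; 0 4)` represents `1`). [cite: Runge1999EndomorphismRingsAbelianSurfaces, §6 Example 17 (p. 300)] -/
theorem not_isSimple_of_mem_humbertLocusPrim_one_inter_four (hZ : Z ∈ humbertLocusPrim 1 ∩ humbertLocusPrim 4) :
    ¬ IsSimple (prinPeriod Z : (Fin 2 ⊕ Fin 2 → ℝ) ≃L[ℝ] (Fin 2 → ℂ)) :=
  not_isSimple_of_mem_humbertPairLocus_nonsimpleClass (Or.inr rfl) (humbertLocusPrim_one_inter_four ▸ hZ)

/-- **"quaternionic multiplication by a maximal order (of discriminant 1) in `M₂(ℤ)`"**: on `𝓗((1 0; 0 4))` the order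
`ℤ[α, β]` of any realising pair has discriminant `d(ℤ[α, β]) = det S/4 = 1` and `ℚ(α, β) ≃ ℍ[ℚ, 1, −4]` (a split
quaternion algebra). [cite: Runge1999EndomorphismRingsAbelianSurfaces, §6 Example 17 (p. 300)] -/
theorem pairDiscr_eq_one_of_discMatrix_eq {q q' : Fin 5 → ℤ} (h : discMatrix q q' = !![1, 0; 0, 4]) : pairDiscr q q' = 1 :=
  pairDiscr_eq_of_discMatrix_eq h (by rw [Matrix.det_fin_two_of]; norm_num)

/-! ### Example 17, continued: the QCM-curves of discriminants `6`, `10`, `15`, `26` -/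

/-- **"two different QCM-curves for discriminant 6, namely `C_{(1 0; 0 24)}` (non-simple, which is a component of
`H₁ ∩ H₂₄`) and `C_{(5 1; 1 5)}` (simple, which is a component of `H₅ ∩ H₈`)"; "for discriminant 10, namely `C_{(1 0; 0 40)}`
(non-simple) and `C_{(5 0; 0 8)}` (simple, which is another component of `H₅ ∩ H₈`)"** — the containments on `𝔥₂`
(the class lists `h_QCM(6) = h_QCM(10) = 2` are row A4-68 FILE 1 `qcmReducedList_six/_ten`).
[cite: Runge1999EndomorphismRingsAbelianSurfaces, §6 Example 17 (p. 300)] -/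
theorem humbertPairLocus_subset_inter_example_seventeen :
    humbertPairLocus !![1, 0; 0, 24] ⊆ humbertLocusOfInvariant 1 ∩ humbertLocusOfInvariant 24 ∧
      humbertPairLocus !![5, 1; 1, 5] ⊆ humbertLocusOfInvariant 5 ∩ humbertLocusOfInvariant 8 ∧
      humbertPairLocus !![1, 0; 0, 40] ⊆ humbertLocusOfInvariant 1 ∩ humbertLocusOfInvariant 40 ∧
      humbertPairLocus !![5, 0; 0, 8] ⊆ humbertLocusOfInvariant 5 ∩ humbertLocusOfInvariant 8 := by
  refine ⟨humbertPairLocus_offDiag_subset_inter (by norm_num), ?_, humbertPairLocus_offDiag_subset_inter (by norm_num),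
    humbertPairLocus_offDiag_subset_inter (by norm_num)⟩
  rw [← isGLEquiv_five_four_eight.humbertPairLocus_eq]
  exact humbertPairLocus_offDiag_subset_inter (by norm_num)

/-- The non-simple labels: `𝓗((1 0; 0 24))` and `𝓗((1 0; 0 40))` carry only non-simple surfaces (they represent `1`).
[cite: Runge1999EndomorphismRingsAbelianSurfaces, §6 Example 17 (p. 300)] -/
theorem not_isSimple_of_mem_humbertPairLocus_one_zero {c : ℤ} (hZ : Z ∈ humbertPairLocus !![1, 0; 0, c]) :
    ¬ IsSimple (prinPeriod Z : (Fin 2 ⊕ Fin 2 → ℝ) ≃L[ℝ] (Fin 2 → ℂ)) := by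
  obtain ⟨q, q', hqS, h₀, h₁⟩ := hZ
  refine not_isSimple_of_not_isSimpleDisc h₀ h₁ ?_
  rw [hqS]
  exact not_isSimpleDisc_of_eq_sq (x := 1) (y := 0) (m := 1) (by norm_num) (by simp [discBinForm])

set_option maxRecDepth 8000 in
/-- **Discriminant 15: "the classes for discriminant matrices are given by `(1 0; 0 60), (4 2; 2 16), (5 0; 0 12), (8 2; 2 8)`
which are not all primitive. Therefore there are at least 4 different QCM-curves of discriminant 15"** — Runge's four
reduced matrices are exactly row A4-68 FILE 1's `qcmReducedList 15`, and `2` of the `4` are primitive (by `decide`).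
[cite: Runge1999EndomorphismRingsAbelianSurfaces, §6 Example 17 (p. 300)] -/
theorem qcmReducedList_fifteen :
    qcmReducedList 15 = [(1, 0, 60), (4, 2, 16), (5, 0, 12), (8, 2, 8)] ∧ qcmClassNumber 15 = 4 ∧
      qcmPrimitiveClassNumber 15 = 2 := by
  refine ⟨by decide, by decide, by decide⟩

set_option maxRecDepth 8000 in
/-- **Discriminant 26: "the classes for discriminant matrices are given by [four matrices] which are all primitive.
Therefore there are 4 different QCM-curves with discriminant 26"** — the four printed matrices are OCR-garbled in the
held scan; row A4-68 FILE 1's enumeration gives the reduced classes `(1 0; 0 104), (5 1; 1 21), (8 0; 0 13), (9 2; 2 12)`,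
all four primitive, confirming the printed COUNTS (by `decide`). [cite: Runge1999EndomorphismRingsAbelianSurfaces, §6 Example 17 (p. 300)] -/
theorem qcmReducedList_twentySix :
    qcmReducedList 26 = [(1, 0, 104), (5, 1, 21), (8, 0, 13), (9, 2, 12)] ∧ qcmClassNumber 26 = 4 ∧
      qcmPrimitiveClassNumber 26 = 4 := by
  refine ⟨by decide, by decide, by decide⟩

end Examples

/-! ## §7 Scope witness: the loci of distinct classes overlap — `E × E` on `N₄ ∩ N₈ ∩ N₁₃` -/

section Caveat

/-- The diagonal point `diag(τ, τ)` of `𝔥₂` (the square `E_τ × E_τ` with its product polarisation, row A4-63).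
[cite: Runge1999EndomorphismRingsAbelianSurfaces, §6 p. 296 ("abelian surfaces which are isogenous to a self product of an elliptic curve")] -/
private theorem singularRelation_diagPoint_const (q : Fin 5 → ℤ) (τ : UpperHalfPlane) :
    singularRelation (fun i ↦ (q i : ℂ)) ((diagPoint fun _ ↦ τ : siegelUpperHalfSpace 2) : Matrix (Fin 2) (Fin 2) ℂ) =
      (q 0 + q 2 : ℂ) * (τ : ℂ) - (q 3 : ℂ) * (τ : ℂ) ^ 2 + q 4 := by
  rw [singularRelation_apply, coe_diagPoint]
  simp [Matrix.diagonal]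
  ring

/-- `diag(τ, τ)` satisfies every relation `(n, b, −n, 0, 0)`: `n z₁ + b z₂ − n z₃ = 0` there. [cite: Runge1999EndomorphismRingsAbelianSurfaces, §6 p. 296] -/
private theorem diagPoint_const_mem_humbertLocus (n b : ℤ) (τ : UpperHalfPlane) :
    (diagPoint fun _ ↦ τ : siegelUpperHalfSpace 2) ∈ humbertLocus (fun i ↦ ((![n, b, -n, 0, 0] : Fin 5 → ℤ) i : ℂ)) := by
  rw [mem_humbertLocus_iff, singularRelation_diagPoint_const]
  simp

/-- **WORKED CAVEAT (numbers, not adjectives): the square `E_τ × E_τ = X_{diag(τ,τ)}` carries the PRIMITIVE relations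
`(1, 0, −1, 0, 0)` [`Δ = 4`], `(1, 2, −1, 0, 0)` [`Δ = 8`], `(1, 3, −1, 0, 0)` [`Δ = 13`] and `(0, 1, 0, 0, 0)` [`Δ = 1`], so
`diag(τ, τ) ∈ 𝓗((4 4; 4 8)) ∩ 𝓗((4 4; 4 13)) ∩ 𝓗((1 0; 0 4))`** — it lies on `N₄ ∩ N₈` through a pair with the
IMPRIMITIVE class `(4 4; 4 8) ~ (4 0; 0 4)`, on `N₄ ∩ N₁₃` (coprime invariants) through a pair with the PRIMITIVE class
`(4 4; 4 13)` of `d = 9`, although its QCM-order `M₂(ℤ) ⊇ ℤ[α, β]` has `d = 1` (class `(1 0; 0 4)`): the pairs of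
primitive relations at a point need not span saturated lattices, the loci `𝓗(S)` of distinct classes overlap, and
`𝓗(S) ⊋ 𝓠(S)` in general. This is why only CONTAINMENTS and the EXHAUSTION of Cor. 15 are formalised, not "component"
or the "only if" of Cor. 9 (iii). [cite: Runge1999EndomorphismRingsAbelianSurfaces, §6 Cor. 9 (iii) (p. 296), Cor. 15 and Example 17 (p. 300)] -/
theorem diagPoint_const_mem_humbertPairLocus (τ : UpperHalfPlane) :
    (diagPoint fun _ ↦ τ : siegelUpperHalfSpace 2) ∈
      humbertPairLocus !![4, 4; 4, 8] ∩ humbertPairLocus !![4, 4; 4, 13] ∩ humbertPairLocus !![1, 0; 0, 4] ∧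
    IsPrimitiveRel ![1, 0, -1, 0, 0] ∧ IsPrimitiveRel ![1, 2, -1, 0, 0] ∧ IsPrimitiveRel ![1, 3, -1, 0, 0] ∧
    ¬ IsPrimitiveDisc !![4, 4; 4, 8] ∧ IsPrimitiveDisc !![4, 4; 4, 13] ∧ IsGLEquiv !![4, 4; 4, 8] !![4, 0; 0, 4] := by
  have prim : ∀ b : ℤ, IsPrimitiveRel ![1, b, -1, 0, 0] := fun b m p h ↦ by
    have h0 : (m • p) 0 = 1 := by rw [← h]; simp
    rw [Pi.smul_apply, smul_eq_mul] at h0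
    exact Int.isUnit_iff.1 (isUnit_of_dvd_one ⟨p 0, h0.symm⟩)
  refine ⟨⟨⟨?_, ?_⟩, ?_⟩, prim 0, prim 2, prim 3, by decide, by decide,
    ⟨!![1, 0; -1, 1], by rw [Matrix.det_fin_two_of]; norm_num, by
      rw [discBaseChange_fin_two]; ext i j; fin_cases i <;> fin_cases j <;> norm_num⟩⟩
  · exact ⟨![1, 0, -1, 0, 0], ![1, 2, -1, 0, 0], by
      ext i j; fin_cases i <;> fin_cases j <;> simp [discMatrix, humbertInvariant, humbertPolar],
      diagPoint_const_mem_humbertLocus 1 0 τ, diagPoint_const_mem_humbertLocus 1 2 τ⟩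
  · exact ⟨![1, 0, -1, 0, 0], ![1, 3, -1, 0, 0], by
      ext i j; fin_cases i <;> fin_cases j <;> simp [discMatrix, humbertInvariant, humbertPolar],
      diagPoint_const_mem_humbertLocus 1 0 τ, diagPoint_const_mem_humbertLocus 1 3 τ⟩
  · refine ⟨![0, 1, 0, 0, 0], ![1, 0, -1, 0, 0], by
      ext i j; fin_cases i <;> fin_cases j <;> simp [discMatrix, humbertInvariant, humbertPolar],
      ?_, diagPoint_const_mem_humbertLocus 1 0 τ⟩
    have h := diagPoint_const_mem_humbertLocus 0 1 τ
    simpa using h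

/-- … and `diag(τ, τ)` lies on the primitive-relation Humbert surfaces `N₁`, `N₄`, `N₈`, `N₁₃` simultaneously (row A4-63
FILE 3: `E × E ∈ H_{b² + 4m²}`). [cite: Runge1999EndomorphismRingsAbelianSurfaces, §6 p. 296 and Example 17 (p. 300)] -/
theorem diagPoint_const_mem_humbertLocusPrim (τ : UpperHalfPlane) :
    (diagPoint fun _ ↦ τ : siegelUpperHalfSpace 2) ∈
      humbertLocusPrim 1 ∩ humbertLocusPrim 4 ∩ humbertLocusPrim 8 ∩ humbertLocusPrim 13 := by
  obtain ⟨⟨⟨h48, h413⟩, h14⟩, p0, p2, p3, -⟩ := diagPoint_const_mem_humbertPairLocus τ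
  have h1 : (diagPoint fun _ ↦ τ : siegelUpperHalfSpace 2) ∈ humbertLocusPrim 1 ∩ humbertLocusPrim 4 := by
    rw [humbertLocusPrim_one_inter_four]; exact h14
  refine ⟨⟨h1, ?_⟩, ?_⟩
  · exact mem_humbertLocusPrim_iff.2 ⟨_, p2, by simp [humbertInvariant], diagPoint_const_mem_humbertLocus 1 2 τ⟩
  · exact mem_humbertLocusPrim_iff.2 ⟨_, p3, by simp [humbertInvariant], diagPoint_const_mem_humbertLocus 1 3 τ⟩

end Caveat

end SiegelModuli

end Literature.AlgebraicGeometry.ModuliOfAbelianVarieties
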